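import Literature.NumberTheory.Sieve.MaynardNFS1
import Literature.NumberTheory.Sieve.MaynardNFLevel
import Literature.NumberTheory.Sieve.MaynardNFS2Sum
import HarnessLib

/-!
# The Maynard–Tao sieve over `𝓞_K`: Lemma 2.3 in `o`-form and Proposition 2.1 (`S₂`)

Topic `Literature/NumberTheory/Sieve`. A. Castillo, C. Hall, R. J. Lemke Oliver, P. Pollack,
L. Thompson, *Bounded gaps between primes in number fields and function fields*, Proc. AMS 143 (2015)
= arXiv:1403.5808, Lemma 2.3 and Proposition 2.1 (`S₂` part). Given that the prime elements have
level of distribution `θ` (`PrimesHaveLevel K θ`; Theorem 2.7 = Hinz's Bombieri–Vinogradov theorem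
for totally real `K`, entering as a HYPOTHESIS) and the prime number theorem for `P(N)`
(`PrimesAsymptotic K`; Mitsui, entering as a HYPOTHESIS), the error terms of Lemma 2.3
(`MaynardNFCounting2.abs_S2_sub_main_le` + `MaynardNFLevel`) are `o(𝔐)`, and together with the
main-term evaluation `MaynardNFS2Sum.S2sum_isLittleO` this proves the `S₂` asymptotic of
Proposition 2.1 (`S2Asymptotic`).

## References

* Castillo–Hall–Lemke Oliver–Pollack–Thompson, arXiv:1403.5808, Lemma 2.3, Lemma 2.4,
  Proposition 2.1, Theorem 2.7. [CastilloEtAl2015]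
* J. Maynard, *Small gaps between primes*, Ann. of Math. 181 (2015), Lemmas 5.2, 5.3, 6.3.
  [MaynardAnnals2015]
-/

noncomputable section

open Finset Filter Topology Asymptotics UniqueFactorizationMonoid NumberField MeasureTheory
  IsDedekindDomain
open scoped NumberField Classical

namespace Literature.NumberTheory.Sieve.MaynardNF

open Literature.NumberTheory.LFunctions Literature.NumberTheory.LFunctions.NumberField
  Literature.NumberTheory.Sieve.MaynardTao Literature.NumberTheory.Sieve.IdealSieve
  Literature.NumberTheory.Sieve.SquarefreeIdeal Module

variable {K : Type*} [Field K] [NumberField K]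
variable {k : ℕ}

/-! ### `1/g` as a sieve weight `W_c/N` -/

/-- The local parameter of `1/g`: `1 + c_𝔭 = N𝔭/(N𝔭 − 2)` for `N𝔭 ≥ 4` (and `c_𝔭 = 0` for the primes
of norm `≤ 3`, which divide `𝔴` in the application). [folklore] -/
def cG (P : Ideal (𝓞 K)) : ℝ :=
  if (Ideal.absNorm P : ℝ) ≤ 3 then 0 else 2 / ((Ideal.absNorm P : ℝ) - 2)

/-- `|cG 𝔭| ≤ 4/N𝔭`. [folklore] -/
theorem abs_cG_le {P : Ideal (𝓞 K)} (hP : Prime P) : |cG P| ≤ 4 / (Ideal.absNorm P : ℝ) := by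
  have h2 : (2 : ℝ) ≤ Ideal.absNorm P := by exact_mod_cast two_le_absNorm_of_prime hP
  rw [cG]
  split_ifs with h3
  · rw [abs_zero]; positivity
  · have h4 : (4 : ℝ) ≤ Ideal.absNorm P := by
      have h3' : (3 : ℝ) < Ideal.absNorm P := not_le.1 h3
      have : 3 < Ideal.absNorm P := by exact_mod_cast h3'
      exact_mod_cast this
    rw [abs_of_pos (div_pos two_pos (by linarith)), div_le_div_iff₀ (by linarith) (by linarith)]
    linarith

/-- `1 + cG 𝔭 ≥ 0`. [folklore] -/
theorem one_add_cG_nonneg {P : Ideal (𝓞 K)} (hP : Prime P) : 0 ≤ 1 + cG P := by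
  have h2 : (2 : ℝ) ≤ Ideal.absNorm P := by exact_mod_cast two_le_absNorm_of_prime hP
  rw [cG]
  split_ifs with h3
  · norm_num
  · have h3' : (3 : ℝ) < Ideal.absNorm P := not_le.1 h3
    have : 0 ≤ 2 / ((Ideal.absNorm P : ℝ) - 2) := div_nonneg zero_le_two (by linarith)
    linarith

/-- **`W_{cG}(𝔲)/N𝔲 = 1/g(𝔲)` on `G1`** when the primes of norm `≤ 3` divide `𝔴`. [folklore] -/
theorem sieveW_cG_div_absNorm {𝔴 : Ideal (𝓞 K)} {B : ℝ}
    (h3 : ∀ P : Ideal (𝓞 K), Prime P → (Ideal.absNorm P : ℝ) ≤ 3 → P ∣ 𝔴) {𝔲 : Ideal (𝓞 K)}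
    (hu : 𝔲 ∈ G1 K 𝔴 B) : sieveW 𝔴 cG 𝔲 / ((Ideal.absNorm 𝔲 : ℕ) : ℝ) = 1 / gId K 𝔲 := by
  obtain ⟨⟨h0, -⟩, hsq, hcop⟩ := mem_G1.1 hu
  have hno := (sup_eq_top_iff_forall_not_dvd h0).1 hcop
  rw [sieveW, if_pos ⟨hcop, hsq⟩, gId, absNorm_of_squarefree hsq, one_div, ← Finset.prod_inv_distrib,
    ← Finset.prod_div_distrib]
  refine Finset.prod_congr rfl fun P hP => ?_
  have hP' := Multiset.mem_toFinset.1 hP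
  have hPp : Prime P := prime_of_normalized_factor P hP'
  have h4 : ¬ (Ideal.absNorm P : ℝ) ≤ 3 := fun hle => hno P hP' (h3 P hPp hle)
  rw [cG, if_neg h4]
  have h4' : (3 : ℝ) < Ideal.absNorm P := not_le.1 h4
  have hN2 : (Ideal.absNorm P : ℝ) - 2 ≠ 0 := by linarith
  have hN0 : (Ideal.absNorm P : ℝ) ≠ 0 := by linarith
  field_simp
  ring

/-- `∑_{G1} 1/g = ∑_{0 < N𝔲 ≤ R} W_{cG}(𝔲)/N𝔲`. [folklore] -/
theorem sum_G1_inv_gId_eq_sieveW {𝔴 : Ideal (𝓞 K)}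
    (h3 : ∀ P : Ideal (𝓞 K), Prime P → (Ideal.absNorm P : ℝ) ≤ 3 → P ∣ 𝔴) (R : ℝ) :
    ∑ 𝔞 ∈ G1 K 𝔴 R, 1 / gId K 𝔞 = ∑ 𝔲 ∈ idealsLE K R, sieveW 𝔴 cG 𝔲 / ((Ideal.absNorm 𝔲 : ℕ) : ℝ) := by
  rw [Finset.sum_congr rfl fun 𝔞 ha => (sieveW_cG_div_absNorm h3 ha).symm, G1, Finset.sum_filter]
  refine Finset.sum_congr rfl fun 𝔲 _ => ?_
  split_ifs with h
  · rfl
  · rw [sieveW, if_neg (fun h' => h ⟨h'.2, h'.1⟩), zero_div]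

/-! ### The size of `y^{(m)}` -/

/-- **`y^{(m)}_max ≤ y_max L (1 + k 2^k)`** when `∑_{G1} 1/φ² ≤ 2` (Lemma 2.4:
`y^{(m)}_𝔲 = κ M + O(y_max κ k L (Z−1) Z^k)`, `|M| ≤ y_max L`, `κ ≤ 1`).
[cite: CastilloEtAl2015, Lemma 2.4; MaynardAnnals2015, Lemma 5.3] -/
theorem abs_ym_le_of {𝔴 : Ideal (𝓞 K)} {B : ℝ}
    (h2 : ∀ P : Ideal (𝓞 K), Prime P → Ideal.absNorm P = 2 → P ∣ 𝔴)
    {y : (Fin k → Ideal (𝓞 K)) → ℝ} (hy : SupportedOn K k 𝔴 B y) {ymax : ℝ}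
    (hymax : ∀ 𝔯, |y 𝔯| ≤ ymax) {m : Fin k} {𝔲 : Fin k → Ideal (𝓞 K)} (hu : 𝔲 ∈ boxG K k 𝔴 B)
    (hZ : ∑ 𝔫 ∈ G1 K 𝔴 B, 1 / idealTotient K 𝔫 ^ 2 - 1 ≤ 1) :
    |ym K k 𝔴 B y m 𝔲| ≤ ymax * (∑ 𝔫 ∈ G1 K 𝔴 B, 1 / idealTotient K 𝔫) * (1 + k * 2 ^ k) := by
  have hy0 : 0 ≤ ymax := le_trans (abs_nonneg _) (hymax 𝔲)
  obtain ⟨L, hL⟩ : ∃ x : ℝ, x = ∑ 𝔫 ∈ G1 K 𝔴 B, 1 / idealTotient K 𝔫 := ⟨_, rfl⟩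
  obtain ⟨Z, hZdef⟩ : ∃ x : ℝ, x = ∑ 𝔫 ∈ G1 K 𝔴 B, 1 / idealTotient K 𝔫 ^ 2 := ⟨_, rfl⟩
  rw [← hZdef] at hZ
  rw [← hL]
  have hpos : ∀ 𝔫 ∈ G1 K 𝔴 B, 0 < idealTotient K 𝔫 := fun 𝔫 hn => idealTotient_pos_of_mem_G1 hn
  have hL0 : 0 ≤ L := by rw [hL]; exact Finset.sum_nonneg fun 𝔫 hn => (one_div_pos.2 (hpos 𝔫 hn)).le
  by_cases hum : 𝔲 m = ⊤
  · have hB : 1 ≤ B := by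
      have := (mem_box_iff.1 (mem_boxG.1 hu).1 m).2
      rwa [hum, Ideal.absNorm_top, Nat.cast_one] at this
    have hZ1 : 1 ≤ Z := by
      have := Finset.single_le_sum (f := fun 𝔫 : Ideal (𝓞 K) => 1 / idealTotient K 𝔫 ^ 2)
        (fun 𝔫 hn => by have := hpos 𝔫 hn; positivity) (top_mem_G1 hB)
      rw [idealTotient_top, one_pow, div_one] at this
      rw [hZdef]; exact this
    have hZ2 : Z ≤ 2 := by linarith
    have hκ0 := kappa_pos h2 hu
    have hκ1 := kappa_le_one hu (K := K)
    have h1 := abs_ym_sub_main_le h2 hy hymax hu hum (m := m)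
    have hM := abs_Mterm_le hy hymax 𝔲 (m := m)
    rw [← hL, ← hZdef] at h1
    rw [← hL] at hM
    have hZk : (Z - 1) * Z ^ k ≤ 1 * 2 ^ k :=
      mul_le_mul hZ (pow_le_pow_left₀ (by linarith) hZ2 k) (by positivity) zero_le_one
    have herr : ymax * kappa K 𝔲 * ((k : ℝ) * (L * ((Z - 1) * Z ^ k))) ≤ ymax * 1 * ((k : ℝ) * (L * (1 * 2 ^ k))) :=
      mul_le_mul (mul_le_mul_of_nonneg_left hκ1 hy0)
        (mul_le_mul_of_nonneg_left (mul_le_mul_of_nonneg_left hZk hL0) (Nat.cast_nonneg k))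
        (by have : 0 ≤ Z - 1 := by linarith
            positivity) (by positivity)
    have hmain : |kappa K 𝔲 * Mterm K B y m 𝔲| ≤ 1 * (ymax * L) := by
      rw [abs_mul, abs_of_pos hκ0]
      exact mul_le_mul hκ1 hM (abs_nonneg _) zero_le_one
    calc |ym K k 𝔴 B y m 𝔲| ≤ |ym K k 𝔴 B y m 𝔲 - kappa K 𝔲 * Mterm K B y m 𝔲| +
          |kappa K 𝔲 * Mterm K B y m 𝔲| := by
            have := abs_add_le (ym K k 𝔴 B y m 𝔲 - kappa K 𝔲 * Mterm K B y m 𝔲) (kappa K 𝔲 * Mterm K B y m 𝔲)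
            rwa [sub_add_cancel] at this
      _ ≤ ymax * 1 * ((k : ℝ) * (L * (1 * 2 ^ k))) + 1 * (ymax * L) := add_le_add (h1.trans herr) hmain
      _ = ymax * L * (1 + k * 2 ^ k) := by ring
  · rw [ym_eq_zero_of_ne hum, abs_zero]; positivity

/-! ### Real-variable bookkeeping for Lemma 2.3 -/

section RealBookkeeping

/-- `(N^n/q)^{1−1/n} = N^{n−1} q^{1/n}/q`. [folklore] -/
theorem s2_rpow_one_sub_inv_eq {n : ℕ} (hn : 1 ≤ n) {N q : ℝ} (hN : 0 < N) (hq : 0 < q) :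
    (N ^ n / q) ^ (1 - 1 / (n : ℝ)) = N ^ (n - 1) * q ^ (1 / (n : ℝ)) / q := by
  have hn0 : (n : ℝ) ≠ 0 := by exact_mod_cast (show n ≠ 0 by omega)
  have hx : 0 < N ^ n / q := by positivity
  rw [sub_eq_add_neg, Real.rpow_add hx, Real.rpow_one, Real.rpow_neg hx.le,
    Real.div_rpow (by positivity) hq.le, one_div, Real.pow_rpow_inv_natCast hN.le (by omega)]
  have hqn : 0 < q ^ ((n : ℝ)⁻¹) := Real.rpow_pos_of_pos hq _
  have hNn : N ^ n = N ^ (n - 1) * N := by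
    conv_lhs => rw [show n = (n - 1) + 1 by omega, pow_succ]
  rw [hNn]
  field_simp

/-- The three `C_s`-quantities of `modErr(𝔮)` are each `≤ Y/N𝔮` under the `Y`-bounds. [folklore] -/
theorem s2_cs_part_le {n : ℕ} (hn : 1 ≤ n) {N Q Y q : ℝ} (hN : 1 ≤ N) (hq1 : 1 ≤ q) (hqQ : q ≤ Q)
    (hY1 : N ^ (n - 1) ≤ Y) (hY2 : Q ≤ Y) (hY3 : N ^ (n - 1) * Q ^ (1 / (n : ℝ)) ≤ Y) :
    N ^ (n - 1) / q + (1 + (N ^ n / q) ^ (1 - 1 / (n : ℝ))) ≤ 3 * Y / q := by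
  have hq0 : 0 < q := by linarith
  have hN0 : 0 < N := by linarith
  have h1 : N ^ (n - 1) / q ≤ Y / q := div_le_div_of_nonneg_right hY1 hq0.le
  have h2 : (1 : ℝ) ≤ Y / q := by rw [le_div_iff₀ hq0]; linarith
  have h3 : (N ^ n / q) ^ (1 - 1 / (n : ℝ)) ≤ Y / q := by
    rw [s2_rpow_one_sub_inv_eq hn hN0 hq0]
    refine div_le_div_of_nonneg_right ?_ hq0.le
    refine le_trans ?_ hY3
    exact mul_le_mul_of_nonneg_left (Real.rpow_le_rpow hq0.le hqQ (by positivity)) (by positivity)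
  have : 3 * Y / q = Y / q + (Y / q + Y / q) := by ring
  rw [this]
  exact add_le_add h1 (add_le_add h2 h3)

/-- `Y`-bounds from `Q ≤ c₂ log N · N^{n/2}`. [folklore] -/
theorem s2_Y_bounds {n : ℕ} (hn : 1 ≤ n) {N Q c₂ : ℝ} (hN : 1 ≤ N) (hlogN : 1 ≤ Real.log N) (hc₂ : 1 ≤ c₂)
    (hQ : Q ≤ c₂ * Real.log N * N ^ ((n : ℝ) / 2)) (hQ1 : 1 ≤ Q) :
    N ^ (n - 1) ≤ c₂ * Real.log N * N ^ ((n : ℝ) - 1 / 2) ∧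
    Q ≤ c₂ * Real.log N * N ^ ((n : ℝ) - 1 / 2) ∧
    N ^ (n - 1) * Q ^ (1 / (n : ℝ)) ≤ (c₂ * Real.log N) ^ 2 * N ^ ((n : ℝ) - 1 / 2) := by
  have hN0 : 0 < N := by linarith
  have hn1 : ((n - 1 : ℕ) : ℝ) = (n : ℝ) - 1 := by
    rw [Nat.cast_sub hn, Nat.cast_one]
  have hpow : (N ^ (n - 1) : ℝ) = N ^ ((n : ℝ) - 1) := by
    rw [← hn1, Real.rpow_natCast]
  have hcl : 1 ≤ c₂ * Real.log N := by nlinarith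
  refine ⟨?_, ?_, ?_⟩
  · rw [hpow]
    calc N ^ ((n : ℝ) - 1) ≤ N ^ ((n : ℝ) - 1 / 2) := Real.rpow_le_rpow_of_exponent_le hN (by linarith)
      _ = 1 * N ^ ((n : ℝ) - 1 / 2) := (one_mul _).symm
      _ ≤ c₂ * Real.log N * N ^ ((n : ℝ) - 1 / 2) := mul_le_mul_of_nonneg_right hcl (by positivity)
  · refine hQ.trans (mul_le_mul_of_nonneg_left ?_ (by positivity))
    refine Real.rpow_le_rpow_of_exponent_le hN ?_
    have : (1 : ℝ) ≤ n := by exact_mod_cast hn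
    linarith
  · -- `Q^{1/n} ≤ (c₂ log N)^{1/n} N^{1/2} ≤ c₂ log N · N^{1/2}`
    have hn0 : (0 : ℝ) < n := by exact_mod_cast (show 0 < n by omega)
    have hQn : Q ^ (1 / (n : ℝ)) ≤ c₂ * Real.log N * N ^ (1 / 2 : ℝ) := by
      have h1 : Q ^ (1 / (n : ℝ)) ≤ (c₂ * Real.log N * N ^ ((n : ℝ) / 2)) ^ (1 / (n : ℝ)) :=
        Real.rpow_le_rpow (by linarith) hQ (by positivity)
      refine h1.trans ?_
      rw [Real.mul_rpow (by positivity) (by positivity), ← Real.rpow_mul hN0.le]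
      have he : (n : ℝ) / 2 * (1 / n) = 1 / 2 := by field_simp
      rw [he]
      refine mul_le_mul_of_nonneg_right ?_ (by positivity)
      calc (c₂ * Real.log N) ^ (1 / (n : ℝ)) ≤ (c₂ * Real.log N) ^ (1 : ℝ) := by
            refine Real.rpow_le_rpow_of_exponent_le hcl ?_
            rw [div_le_one hn0]; exact_mod_cast hn
        _ = c₂ * Real.log N := Real.rpow_one _
    rw [hpow]
    calc N ^ ((n : ℝ) - 1) * Q ^ (1 / (n : ℝ)) ≤ N ^ ((n : ℝ) - 1) * (c₂ * Real.log N * N ^ (1 / 2 : ℝ)) :=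
          mul_le_mul_of_nonneg_left hQn (by positivity)
      _ = c₂ * Real.log N * (N ^ ((n : ℝ) - 1) * N ^ (1 / 2 : ℝ)) := by ring
      _ = c₂ * Real.log N * N ^ ((n : ℝ) - 1 / 2) := by
          rw [← Real.rpow_add hN0]
          congr 2
          ring
      _ = 1 * (c₂ * Real.log N) * N ^ ((n : ℝ) - 1 / 2) := by ring
      _ ≤ (c₂ * Real.log N) * (c₂ * Real.log N) * N ^ ((n : ℝ) - 1 / 2) :=
          mul_le_mul_of_nonneg_right (mul_le_mul_of_nonneg_right hcl (by positivity)) (by positivity)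
      _ = _ := by ring

/-- Uniform `Y = (c₂ log N)² N^{n−1/2}`. [folklore] -/
theorem s2_Y_bounds' {n : ℕ} (hn : 1 ≤ n) {N Q c₂ : ℝ} (hN : 1 ≤ N) (hlogN : 1 ≤ Real.log N) (hc₂ : 1 ≤ c₂)
    (hQ : Q ≤ c₂ * Real.log N * N ^ ((n : ℝ) / 2)) (hQ1 : 1 ≤ Q) :
    N ^ (n - 1) ≤ (c₂ * Real.log N) ^ 2 * N ^ ((n : ℝ) - 1 / 2) ∧
    Q ≤ (c₂ * Real.log N) ^ 2 * N ^ ((n : ℝ) - 1 / 2) ∧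
    N ^ (n - 1) * Q ^ (1 / (n : ℝ)) ≤ (c₂ * Real.log N) ^ 2 * N ^ ((n : ℝ) - 1 / 2) := by
  obtain ⟨h1, h2, h3⟩ := s2_Y_bounds hn hN hlogN hc₂ hQ hQ1
  have hcl : 1 ≤ c₂ * Real.log N := by nlinarith
  have hN0 : 0 < N := by linarith
  have hup : c₂ * Real.log N * N ^ ((n : ℝ) - 1 / 2) ≤ (c₂ * Real.log N) ^ 2 * N ^ ((n : ℝ) - 1 / 2) := by
    refine mul_le_mul_of_nonneg_right ?_ (by positivity)
    nlinarith
  exact ⟨h1.trans hup, h2.trans hup, h3⟩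

/-- `Q = N𝔴 R² ≤ c₂ log N · N^{d/2}` (`R² = |A|^{θ−2δ} ≤ |A|^{1/2}`, `N𝔴 ≤ log N`). [folklore] -/
theorem s2_Q_le {n : ℕ} {N A w R c₂ η₀ logN : ℝ} (hN : 1 ≤ N) (hc₂ : 1 ≤ c₂) (hA₂ : A ≤ c₂ * N ^ n)
    (hA1 : 1 ≤ A) (hη2 : 2 * η₀ ≤ 1 / 2) (hR : R = A ^ η₀) (hw : w ≤ logN) (hlogN : 1 ≤ logN) :
    w * (R * R) ≤ c₂ * logN * N ^ ((n : ℝ) / 2) := by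
  have hNpos : 0 < N := by linarith
  have hApos : 0 < A := by linarith
  have hNn : (N : ℝ) ^ n = N ^ (n : ℝ) := (Real.rpow_natCast N n).symm
  have hR2 : R * R = A ^ (2 * η₀) := by
    rw [hR, ← Real.rpow_add hApos]; congr 1; ring
  have hR2half : R * R ≤ A ^ (1 / 2 : ℝ) := by
    rw [hR2]; exact Real.rpow_le_rpow_of_exponent_le hA1 hη2
  have h1 : A ^ (1 / 2 : ℝ) ≤ c₂ * N ^ ((n : ℝ) / 2) := by
    calc A ^ (1 / 2 : ℝ) ≤ (c₂ * N ^ n) ^ (1 / 2 : ℝ) := Real.rpow_le_rpow hApos.le hA₂ (by norm_num)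
      _ = c₂ ^ (1 / 2 : ℝ) * N ^ ((n : ℝ) / 2) := by
          rw [Real.mul_rpow (by linarith) (by positivity), hNn, ← Real.rpow_mul hNpos.le]; ring_nf
      _ ≤ c₂ * N ^ ((n : ℝ) / 2) := by
          refine mul_le_mul_of_nonneg_right ?_ (by positivity)
          calc c₂ ^ (1 / 2 : ℝ) ≤ c₂ ^ (1 : ℝ) := Real.rpow_le_rpow_of_exponent_le hc₂ (by norm_num)
            _ = c₂ := Real.rpow_one _
  calc w * (R * R) ≤ logN * (c₂ * N ^ ((n : ℝ) / 2)) :=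
        mul_le_mul hw (hR2half.trans h1) (by rw [hR]; positivity) (by linarith)
    _ = _ := by ring

/-- Bookkeeping: the level/shift/unit error terms of Lemma 2.3 against the main term `𝔐`
(`N^d ≤ 𝔐 (log N)^{k+1} Φ`): `≤ (K₁/log N + K₂ (log N)^{7k+3+4^k+r} N^{-1/2}) 𝔐`. [folklore] -/
theorem s2_E23_le {k n r : ℕ} {logN Nn Nh M lmax2 Gmax cL LEV Clev CS Sω Cω c₂ R2LN CN Uu Cu Φ : ℝ}
    (hlogN : 1 ≤ logN) (hNn : 0 ≤ Nn) (hNh : 0 ≤ Nh) (hM : 0 ≤ M)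
    (hl : lmax2 ≤ Gmax ^ 2 * (cL * logN) ^ (4 * k)) (hcL : 0 ≤ cL)
    (hLEV0 : 0 ≤ LEV) (hLEV : LEV ≤ Clev * Nn / logN ^ (5 * k + 2)) (hClev : 0 ≤ Clev)
    (hCS : 0 ≤ CS) (hS0 : 0 ≤ Sω) (hS : Sω ≤ Cω * (((n : ℝ) + 2) * logN) ^ (4 ^ k)) (hCω : 0 ≤ Cω)
    (hc₂ : 1 ≤ c₂) (hR0 : 0 ≤ R2LN) (hR2 : R2LN ≤ c₂ * (Nh * Nn) * (CN * ((n : ℝ) + 1) * logN) ^ (2 * k))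
    (hCN : 0 ≤ CN) (hU0 : 0 ≤ Uu) (hU : Uu ≤ Cu * (3 * logN) ^ r) (hCu : 0 ≤ Cu)
    (hΦ : 0 ≤ Φ) (hmain : Nn ≤ M * (logN ^ (k + 1) * Φ)) :
    lmax2 * (LEV + CS * (3 * ((c₂ * logN) ^ 2 * (Nh * Nn)) * Sω)) + lmax2 * R2LN * Uu ≤
      ((Gmax ^ 2 * cL ^ (4 * k) * Clev * Φ) / logN +
        (Gmax ^ 2 * cL ^ (4 * k) * Φ * (CS * 3 * c₂ ^ 2 * Cω * ((n : ℝ) + 2) ^ (4 ^ k) +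
          c₂ * (CN * ((n : ℝ) + 1)) ^ (2 * k) * Cu * 3 ^ r)) * logN ^ (7 * k + 3 + 4 ^ k + r) * Nh) * M := by
  have hlogN0 : 0 < logN := by linarith
  obtain ⟨G2, hG2⟩ : ∃ x : ℝ, x = Gmax ^ 2 * cL ^ (4 * k) := ⟨_, rfl⟩
  have hG20 : 0 ≤ G2 := by rw [hG2]; positivity
  have hl' : lmax2 ≤ G2 * logN ^ (4 * k) := by rw [hG2, mul_assoc, ← mul_pow]; exact hl
  -- T₁
  have hpow1 : logN ^ (5 * k + 2) = logN ^ (4 * k) * logN ^ (k + 1) * logN := by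
    rw [← pow_add, ← pow_succ]; ring_nf
  have hT1 : lmax2 * LEV ≤ (G2 * Clev * Φ) / logN * M := by
    calc lmax2 * LEV ≤ (G2 * logN ^ (4 * k)) * (Clev * Nn / logN ^ (5 * k + 2)) :=
          mul_le_mul hl' hLEV hLEV0 (by positivity)
      _ ≤ (G2 * logN ^ (4 * k)) * (Clev * (M * (logN ^ (k + 1) * Φ)) / logN ^ (5 * k + 2)) := by
          refine mul_le_mul_of_nonneg_left (div_le_div_of_nonneg_right
            (mul_le_mul_of_nonneg_left hmain hClev) (by positivity)) (by positivity)
      _ = (G2 * Clev * Φ) / logN * M := by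
          rw [hpow1]; field_simp
  -- T₂
  have hbig2 : logN ^ (4 * k) * logN ^ 2 * logN ^ (4 ^ k) * logN ^ (k + 1) ≤ logN ^ (7 * k + 3 + 4 ^ k + r) := by
    rw [← pow_add, ← pow_add, ← pow_add,
      show 7 * k + 3 + 4 ^ k + r = (4 * k + 2 + 4 ^ k + (k + 1)) + (2 * k + r) by ring]
    exact pow_le_pow_right₀ hlogN (Nat.le_add_right _ _)
  have hT2 : lmax2 * (CS * (3 * ((c₂ * logN) ^ 2 * (Nh * Nn)) * Sω)) ≤
      (G2 * Φ * (CS * 3 * c₂ ^ 2 * Cω * ((n : ℝ) + 2) ^ (4 ^ k))) * logN ^ (7 * k + 3 + 4 ^ k + r) * Nh * M := by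
    have h1 : CS * (3 * ((c₂ * logN) ^ 2 * (Nh * Nn)) * Sω) ≤
        CS * (3 * ((c₂ * logN) ^ 2 * (Nh * (M * (logN ^ (k + 1) * Φ)))) * (Cω * (((n : ℝ) + 2) * logN) ^ (4 ^ k))) := by
      refine mul_le_mul_of_nonneg_left ?_ hCS
      refine mul_le_mul ?_ hS hS0 (by positivity)
      exact mul_le_mul_of_nonneg_left (mul_le_mul_of_nonneg_left (mul_le_mul_of_nonneg_left hmain hNh)
        (by positivity)) (by norm_num)
    calc _ ≤ (G2 * logN ^ (4 * k)) * (CS * (3 * ((c₂ * logN) ^ 2 * (Nh * (M * (logN ^ (k + 1) * Φ)))) *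
          (Cω * (((n : ℝ) + 2) * logN) ^ (4 ^ k)))) := mul_le_mul hl' h1 (by positivity) (by positivity)
      _ = (G2 * Φ * (CS * 3 * c₂ ^ 2 * Cω * ((n : ℝ) + 2) ^ (4 ^ k))) *
          (logN ^ (4 * k) * logN ^ 2 * logN ^ (4 ^ k) * logN ^ (k + 1)) * Nh * M := by
          rw [mul_pow ((n : ℝ) + 2) logN]; ring
      _ ≤ _ := by
          refine mul_le_mul_of_nonneg_right (mul_le_mul_of_nonneg_right
            (mul_le_mul_of_nonneg_left hbig2 (by positivity)) hNh) hM
  -- T₃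
  have hbig3 : logN ^ (4 * k) * logN ^ (2 * k) * logN ^ r * logN ^ (k + 1) ≤ logN ^ (7 * k + 3 + 4 ^ k + r) := by
    rw [← pow_add, ← pow_add, ← pow_add,
      show 7 * k + 3 + 4 ^ k + r = (4 * k + 2 * k + r + (k + 1)) + (2 + 4 ^ k) by ring]
    exact pow_le_pow_right₀ hlogN (Nat.le_add_right _ _)
  have hT3 : lmax2 * R2LN * Uu ≤
      (G2 * Φ * (c₂ * (CN * ((n : ℝ) + 1)) ^ (2 * k) * Cu * 3 ^ r)) * logN ^ (7 * k + 3 + 4 ^ k + r) * Nh * M := by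
    have h1 : R2LN ≤ c₂ * (Nh * (M * (logN ^ (k + 1) * Φ))) * (CN * ((n : ℝ) + 1) * logN) ^ (2 * k) :=
      hR2.trans (mul_le_mul_of_nonneg_right (mul_le_mul_of_nonneg_left
        (mul_le_mul_of_nonneg_left hmain hNh) (by linarith)) (by positivity))
    calc lmax2 * R2LN * Uu ≤ (G2 * logN ^ (4 * k)) *
          (c₂ * (Nh * (M * (logN ^ (k + 1) * Φ))) * (CN * ((n : ℝ) + 1) * logN) ^ (2 * k)) *
          (Cu * (3 * logN) ^ r) :=
          mul_le_mul (mul_le_mul hl' h1 hR0 (by positivity)) hU hU0 (by positivity)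
      _ = (G2 * Φ * (c₂ * (CN * ((n : ℝ) + 1)) ^ (2 * k) * Cu * 3 ^ r)) *
          (logN ^ (4 * k) * logN ^ (2 * k) * logN ^ r * logN ^ (k + 1)) * Nh * M := by
          rw [mul_pow, mul_pow (3 : ℝ)]; ring
      _ ≤ _ := by
          refine mul_le_mul_of_nonneg_right (mul_le_mul_of_nonneg_right
            (mul_le_mul_of_nonneg_left hbig3 (by positivity)) hNh) hM
  rw [hG2] at hT1 hT2 hT3
  calc lmax2 * (LEV + CS * (3 * ((c₂ * logN) ^ 2 * (Nh * Nn)) * Sω)) + lmax2 * R2LN * Uu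
      = lmax2 * LEV + lmax2 * (CS * (3 * ((c₂ * logN) ^ 2 * (Nh * Nn)) * Sω)) + lmax2 * R2LN * Uu := by ring
    _ ≤ _ := add_le_add (add_le_add hT1 hT2) hT3
    _ = _ := by ring

/-- Bookkeeping: the `1/g`-junk error of Lemma 2.3 against `𝔐 = (|A|/N𝔴) P^k`
(`|P(N)| c_K log|A(N)| ≤ 2|A(N)|`). [folklore] -/
theorem s2_E1_le {k : ℕ} (hk : 1 ≤ k) {Pn dN w Gmax L ck Lg P T CZg Dh A ρ logR logA : ℝ}
    (hPn : 0 ≤ Pn) (hd : 0 < dN) (hw : 0 < w) (hL0 : 0 ≤ L) (hL : L ≤ 3 * P)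
    (hLg0 : 0 ≤ Lg) (hLg : Lg ≤ 3 * P) (hP0 : 0 ≤ P) (hT0 : 0 ≤ T) (hT : T ≤ CZg * Dh)
    (hP : P = ρ * dN * logR) (hρ : 0 ≤ ρ) (hRA : logR ≤ logA) (hPnA : ρ * Pn * logA ≤ 2 * A) :
    Pn / (dN * w) * ((Gmax * L * ck) ^ 2 * Lg ^ (k - 1) * T) ≤
      (2 * Gmax ^ 2 * ck ^ 2 * 3 ^ (k + 1) * CZg * Dh) * (A / w * P ^ k) := by
  have h1 : (Gmax * L * ck) ^ 2 ≤ (Gmax * (3 * P) * ck) ^ 2 := by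
    have : |Gmax * L * ck| ≤ |Gmax * (3 * P) * ck| := by
      rw [abs_mul, abs_mul, abs_mul (Gmax * (3 * P)), abs_mul Gmax (3 * P), abs_of_nonneg hL0,
        abs_of_nonneg (by positivity : (0 : ℝ) ≤ 3 * P)]
      exact mul_le_mul_of_nonneg_right (mul_le_mul_of_nonneg_left hL (abs_nonneg _)) (abs_nonneg _)
    exact sq_le_sq.2 this
  have h2 : Lg ^ (k - 1) ≤ (3 * P) ^ (k - 1) := pow_le_pow_left₀ hLg0 hLg _
  have h3 : (Gmax * L * ck) ^ 2 * Lg ^ (k - 1) * T ≤ (Gmax * (3 * P) * ck) ^ 2 * (3 * P) ^ (k - 1) * (CZg * Dh) :=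
    mul_le_mul (mul_le_mul h1 h2 (by positivity) (by positivity)) hT hT0 (by positivity)
  have hpow : (3 * P) ^ 2 * (3 * P) ^ (k - 1) = 3 ^ (k + 1) * P * P ^ k := by
    rw [← pow_add, show 2 + (k - 1) = k + 1 by omega, mul_pow, pow_succ]; ring
  have hkey : Pn / dN * P ≤ 2 * A := by
    rw [hP, show Pn / dN * (ρ * dN * logR) = ρ * Pn * logR by field_simp]
    exact (mul_le_mul_of_nonneg_left hRA (by positivity)).trans hPnA
  calc Pn / (dN * w) * ((Gmax * L * ck) ^ 2 * Lg ^ (k - 1) * T)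
      ≤ Pn / (dN * w) * ((Gmax * (3 * P) * ck) ^ 2 * (3 * P) ^ (k - 1) * (CZg * Dh)) :=
        mul_le_mul_of_nonneg_left h3 (by positivity)
    _ = (Gmax ^ 2 * ck ^ 2 * 3 ^ (k + 1) * CZg * Dh) * (Pn / dN * P) * (P ^ k / w) := by
        have e : (Gmax * (3 * P) * ck) ^ 2 * (3 * P) ^ (k - 1) = Gmax ^ 2 * ck ^ 2 * ((3 * P) ^ 2 * (3 * P) ^ (k - 1)) := by
          ring
        rw [e, hpow]
        field_simp
    _ ≤ (Gmax ^ 2 * ck ^ 2 * 3 ^ (k + 1) * CZg * Dh) * (2 * A) * (P ^ k / w) := by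
        refine mul_le_mul_of_nonneg_right (mul_le_mul_of_nonneg_left hkey ?_) (by positivity)
        have : 0 ≤ CZg * Dh := hT0.trans hT
        have e : Gmax ^ 2 * ck ^ 2 * 3 ^ (k + 1) * CZg * Dh = Gmax ^ 2 * ck ^ 2 * 3 ^ (k + 1) * (CZg * Dh) := by ring
        rw [e]; positivity
    _ = _ := by ring

end RealBookkeeping

/-! ### Eventual facts along `N` for the `1/g`-sums -/

/-- **`∑_{G1} 1/g ≤ 3 c_K (φ(𝔴)/N𝔴) log R` eventually** along `𝔴(N), R(N)`.
[cite: CastilloEtAl2015, proof of Proposition 2.1] -/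
theorem eventually_sum_G1_inv_gId_le_three [IsTotallyReal K] {θ δ : ℝ} (hη : 0 < θ / 2 - δ) :
    ∀ᶠ N : ℝ in atTop, ∑ 𝔞 ∈ G1 K (paramW K N) (nfR K θ δ N), 1 / gId K 𝔞 ≤
      3 * (dedekindZeta_residue K * (idealTotient K (paramW K N) / (Ideal.absNorm (paramW K N) : ℝ)) *
        Real.log (nfR K θ δ N)) := by
  obtain ⟨C, Z, hC0, hZ0, hsharp⟩ := abs_sum_sieveW_div_sub_sharp (K := K)
  obtain ⟨Kc, hKc⟩ : ∃ x : ℝ, x = Real.exp ((1 + 2 * 4) * Z) *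
      (max C (dedekindZeta_residue K) + 4 * dedekindZeta_residue K) := ⟨_, rfl⟩
  have hev1 : ∀ᶠ N : ℝ in atTop, Real.exp ((1 + 2 * 4) * Z) * (paramD0 N ^ (-(1 : ℝ) / 4) /
      ∑ 𝔢 ∈ idealDivisors K (paramW K N), (idealMoebius 𝔢 : ℝ) / Ideal.absNorm 𝔢) ≤ 1 := by
    have h1 := (tendsto_eps_param (K := K)).const_mul (Real.exp ((1 + 2 * 4) * Z))
    rw [mul_zero] at h1
    exact h1.eventually (eventually_le_nhds one_pos)
  have hev2 : ∀ᶠ N : ℝ in atTop, Kc / dedekindZeta_residue K *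
      ((1 + ∑ 𝔢 ∈ idealDivisors K (paramW K N), (1 + Real.log (Ideal.absNorm 𝔢)) / Ideal.absNorm 𝔢) /
        ((∑ 𝔢 ∈ idealDivisors K (paramW K N), (idealMoebius 𝔢 : ℝ) / Ideal.absNorm 𝔢) *
          Real.log (nfR K θ δ N))) ≤ 1 := by
    have h1 := (tendsto_E_param (K := K) hη).const_mul (Kc / dedekindZeta_residue K)
    rw [mul_zero] at h1
    exact h1.eventually (eventually_le_nhds one_pos)
  filter_upwards [hev1, hev2, tendsto_paramD0_atTop.eventually_ge_atTop 1,
    (tendsto_nfR_atTop (K := K) hη).eventually_gt_atTop 1,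
    eventually_dvd_paramW_of_absNorm_le (K := K) 3] with N h1 h2 hD1 hR1 h3
  rw [sum_G1_inv_gId_eq_sieveW h3]
  have h := sum_idealsLE_sieveW_div_le_three_mul hC0 hsharp (paramW_ne_bot N) hD1
    (fun P hP hle => dvd_paramW_of_prime_of_absNorm_le hP hle) hR1 (by norm_num : (0 : ℝ) ≤ 4)
    (fun P hP => abs_cG_le hP) le_rfl hKc h1 h2
  rwa [dsum_paramW_eq] at h

/-- **`(∑_{G1} 1/g²)^c − 1 ≪ D₀^{-1/2}` eventually.** [cite: CastilloEtAl2015, §2.2] -/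
theorem eventually_gSqSum_pow_sub_one_le [IsTotallyReal K] (c : ℕ) {θ δ : ℝ} (hη : 0 < θ / 2 - δ) :
    ∃ CZ : ℝ, 0 ≤ CZ ∧ ∀ᶠ N : ℝ in atTop,
      0 ≤ (∑ 𝔞 ∈ G1 K (paramW K N) (nfR K θ δ N), 1 / gId K 𝔞 ^ 2) ^ c - 1 ∧
      (∑ 𝔞 ∈ G1 K (paramW K N) (nfR K θ δ N), 1 / gId K 𝔞 ^ 2) ^ c - 1 ≤
        CZ * paramD0 N ^ (-(1 : ℝ) / 2) := by
  obtain ⟨Z, hZ0, hZ⟩ := sum_inv_prod_sub_sq_le (K := K)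
  refine ⟨c * 2 ^ (c - 1) * (9 * Z * Real.exp (9 * Z)), by positivity, ?_⟩
  have hτ : Tendsto (fun N : ℝ => 9 * Z * Real.exp (9 * Z) * paramD0 N ^ (-(1 : ℝ) / 2)) atTop (𝓝 0) := by
    have h1 : Tendsto (fun N : ℝ => 9 * Z * Real.exp (9 * Z) * paramD0 N ^ (-(1 / 2 : ℝ))) atTop
        (𝓝 (9 * Z * Real.exp (9 * Z) * 0)) :=
      ((tendsto_rpow_neg_atTop (by norm_num : (0 : ℝ) < 1 / 2)).comp tendsto_paramD0_atTop).const_mul _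
    rw [mul_zero] at h1
    refine h1.congr' (Eventually.of_forall fun N => ?_)
    norm_num
  filter_upwards [hτ.eventually (eventually_le_nhds one_pos), tendsto_paramD0_atTop.eventually_ge_atTop 2,
    (tendsto_nfR_atTop (K := K) hη).eventually_ge_atTop 1] with N hτ1 hD2 hR1
  obtain ⟨L₂, hL₂⟩ : ∃ x : ℝ, x = ∑ 𝔞 ∈ G1 K (paramW K N) (nfR K θ δ N), 1 / gId K 𝔞 ^ 2 := ⟨_, rfl⟩
  rw [← hL₂]
  have h1 := sum_G1_inv_gId_sq_sub_one_eq (paramW K N) hR1 (K := K)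
  rw [← hL₂] at h1
  have h2 := hZ 2 (paramW K N) (paramW_ne_bot N) (paramD0 N) (by linarith) (by exact_mod_cast hD2)
    (fun P hP hle => dvd_paramW_of_prime_of_absNorm_le hP hle) (nfR K θ δ N)
  have hτle : L₂ - 1 ≤ 9 * Z * Real.exp (9 * Z) * paramD0 N ^ (-(1 : ℝ) / 2) := by
    rw [h1]
    refine h2.trans (le_of_eq ?_)
    norm_num
  have hL₂1 : 1 ≤ L₂ := by
    have htop : (⊤ : Ideal (𝓞 K)) ∈ G1 K (paramW K N) (nfR K θ δ N) := top_mem_G1 hR1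
    have := Finset.single_le_sum (f := fun 𝔞 : Ideal (𝓞 K) => 1 / gId K 𝔞 ^ 2)
      (fun 𝔞 _ => by positivity) htop
    rw [gId_top, one_pow, div_one] at this
    rw [hL₂]; exact this
  have hτ0 : 0 ≤ 9 * Z * Real.exp (9 * Z) * paramD0 N ^ (-(1 : ℝ) / 2) := by positivity
  have hL₂2 : L₂ ≤ 2 := by linarith
  constructor
  · linarith [one_le_pow₀ (M₀ := ℝ) hL₂1 (n := c)]
  · calc L₂ ^ c - 1 ≤ c * (L₂ - 1) * L₂ ^ (c - 1) := SquarefreeSums.pow_sub_one_le hL₂1 c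
      _ ≤ c * (9 * Z * Real.exp (9 * Z) * paramD0 N ^ (-(1 : ℝ) / 2)) * 2 ^ (c - 1) := by
          refine mul_le_mul (mul_le_mul_of_nonneg_left hτle (Nat.cast_nonneg c))
            (pow_le_pow_left₀ (by linarith) hL₂2 _) (by positivity) (by positivity)
      _ = _ := by ring

/-! ### The sum over moduli of the shift/`C_s` error -/

/-- `∑_{𝔮 sqfree, N𝔮 ≤ Q} c^{ω(𝔮)} modErr(𝔮) ≤ ∑ c^ω 𝓔(N;𝔮) + 3 C_s Y ∑ c^ω/φ(𝔮)` under the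
`Y`-bounds (`N𝔮 ≥ φ(𝔮)`). [cite: CastilloEtAl2015, proof of Lemma 2.3 (the O-terms summed over 𝔯)] -/
theorem sum_pow_omegaI_mul_modErr_le (hn : 1 ≤ finrank ℚ K) {c C_s N Q Y : ℝ} (hc : 0 ≤ c)
    (hCs : 0 ≤ C_s) (hN : 1 ≤ N) (hY1 : N ^ (finrank ℚ K - 1) ≤ Y) (hY2 : Q ≤ Y)
    (hY3 : N ^ (finrank ℚ K - 1) * Q ^ (1 / (finrank ℚ K : ℝ)) ≤ Y) :
    ∑ 𝔮 ∈ (idealsLE K Q).filter (fun 𝔮 => Squarefree 𝔮), c ^ omegaI 𝔮 * modErr K N C_s 𝔮 ≤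
      ∑ 𝔮 ∈ (idealsLE K Q).filter (fun 𝔮 => Squarefree 𝔮), c ^ omegaI 𝔮 * primesAErr K N 𝔮 +
        C_s * (3 * Y) * ∑ 𝔮 ∈ (idealsLE K Q).filter (fun 𝔮 => Squarefree 𝔮), c ^ omegaI 𝔮 / idealTotient K 𝔮 := by
  rw [Finset.mul_sum, ← Finset.sum_add_distrib]
  refine Finset.sum_le_sum fun 𝔮 hq => ?_
  obtain ⟨hq0, hqQ⟩ := mem_idealsLE.1 (Finset.mem_filter.1 hq).1
  have hq1 : (1 : ℝ) ≤ Ideal.absNorm 𝔮 := by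
    exact_mod_cast Nat.one_le_iff_ne_zero.2 (by rwa [Ne, Ideal.absNorm_eq_zero_iff])
  have hφ0 : 0 < idealTotient K 𝔮 := idealTotient_pos hq0
  have hφle : idealTotient K 𝔮 ≤ Ideal.absNorm 𝔮 := by
    have := idealTotient_div_absNorm_le_one hq0 (K := K)
    rwa [div_le_one (by linarith)] at this
  have hcs := s2_cs_part_le hn hN hq1 hqQ hY1 hY2 hY3
  rw [modErr, mul_add]
  refine add_le_add le_rfl ?_
  have hcω : 0 ≤ c ^ omegaI 𝔮 := by positivity
  calc c ^ omegaI 𝔮 * (C_s * (N ^ (finrank ℚ K - 1) / Ideal.absNorm 𝔮 +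
        (1 + (N ^ finrank ℚ K / Ideal.absNorm 𝔮) ^ (1 - 1 / (finrank ℚ K : ℝ)))))
      ≤ c ^ omegaI 𝔮 * (C_s * (3 * Y / Ideal.absNorm 𝔮)) :=
        mul_le_mul_of_nonneg_left (mul_le_mul_of_nonneg_left hcs hCs) hcω
    _ ≤ c ^ omegaI 𝔮 * (C_s * (3 * Y / idealTotient K 𝔮)) := by
        have hY0 : 0 ≤ 3 * Y := by
          have : (0 : ℝ) ≤ N ^ (finrank ℚ K - 1) := by positivity
          linarith
        exact mul_le_mul_of_nonneg_left (mul_le_mul_of_nonneg_left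
          (div_le_div_of_nonneg_left hY0 hφ0 hφle) hCs) hcω
    _ = C_s * (3 * Y) * (c ^ omegaI 𝔮 / idealTotient K 𝔮) := by ring

/-! ### Lemma 2.3 in `o`-form -/

/-- `log x ≤ ε x^s` eventually (`s > 0`). [folklore] -/
theorem eventually_log_le_mul_rpow {s ε : ℝ} (hs : 0 < s) (hε : 0 < ε) :
    ∀ᶠ N : ℝ in atTop, Real.log N ≤ ε * N ^ s := by
  filter_upwards [(isLittleO_log_rpow_atTop hs).bound hε, eventually_ge_atTop 1] with N hN hN1
  rw [Real.norm_of_nonneg (Real.log_nonneg hN1), Real.norm_of_nonneg (Real.rpow_nonneg (by linarith) s)] at hN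
  exact hN

/-- **The pair-error sum of Lemma 2.3 at fixed `N`** (level of distribution + shift + unit
count, against `𝔐 = (|A|/N𝔴) P^k`): with all the size facts at `N` as hypotheses,
`∑_{𝔡,𝔢} |λ_𝔡λ_𝔢| pairErr(𝔡,𝔢) ≤ (K_A/log N + K_B (log N)^{7k+3+4^k+r} N^{-1/2}) 𝔐`.
[cite: CastilloEtAl2015, proof of Lemma 2.3] -/
theorem s2_pairErr_sum_le_at [IsTotallyReal K] {h : Fin k → 𝓞 K} {θ δ : ℝ} (hδ : 0 < δ)
    (hη2 : 2 * (θ / 2 - δ) ≤ 1 / 2) {G : (Fin k → ℝ) → ℝ} {Gmax : ℝ} (hG0 : 0 ≤ Gmax)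
    (hGmax : ∀ x ∈ maynardSimplex k, |G x| ≤ Gmax) {m : Fin k} {N : ℝ} (hN1 : 1 ≤ N)
    (hlogN : 1 ≤ Real.log N) {Cu : ℝ} (hCu0 : 0 ≤ Cu) (hCu : GeneratorCount K Cu)
    {C_s : ℝ} (hCs : ShiftBound K (h m) C_s) {CN : ℝ}
    (hCN : ∀ (𝔴 : Ideal (𝓞 K)) (B : ℝ), 2 ≤ B → ∑ 𝔞 ∈ G1 K 𝔴 B, 1 / (Ideal.absNorm 𝔞 : ℝ) ≤ CN * Real.log B)
    {n : ℕ} (hn : n = finrank ℚ K) (hn1 : 1 ≤ n) {r : ℕ} (hr : r = Units.rank K)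
    {Clev : ℝ} (hlevN : ∀ Q : ℝ, Q ≤ (cardA K N : ℝ) ^ θ → Q ≤ N ^ finrank ℚ K →
      ∑ 𝔮 ∈ (idealsLE K Q).filter (fun 𝔮 => Squarefree 𝔮), ((4 : ℝ) ^ k) ^ omegaI 𝔮 * primesAErr K N 𝔮 ≤
        Clev * N ^ finrank ℚ K / Real.log N ^ (5 * k + 2))
    {Cω : ℝ} (hCω : ∀ x : ℝ, 2 ≤ x →
      ∑ 𝔮 ∈ (idealsLE K x).filter (fun 𝔮 => Squarefree 𝔮), ((4 : ℝ) ^ k) ^ omegaI 𝔮 / idealTotient K 𝔮 ≤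
        Cω * Real.log x ^ (4 ^ k))
    {c₁ A : ℝ} (hc₁0 : 0 < c₁) (hA₁ : c₁ * N ^ n ≤ A) (hA : A = (cardA K N : ℝ)) (hA1 : 1 ≤ A)
    {c₂ : ℝ} (hc₂1 : 1 ≤ c₂) (hA₂ : A ≤ c₂ * N ^ n) (hlogc₂ : Real.log c₂ ≤ Real.log N)
    {sc : ℝ} (hsc : sc = CastilloEtAl2015.shiftConst K (h m)) (hsc0 : 0 ≤ sc)
    (hlogsc : Real.log (2 + sc) ≤ Real.log N)
    {Cφ : ℝ} (hCφ0 : 0 < Cφ) {dN : ℝ} (hdφ : 1 / (Cφ * Real.log (paramD0 N)) ≤ dN) (hd1 : dN ≤ 1)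
    (hlD0 : 0 < Real.log (paramD0 N)) (hlDle : Real.log (paramD0 N) ≤ Real.log N)
    {Φ : ℝ} (hΦ : Φ = (Cφ / dedekindZeta_residue K) ^ k / c₁)
    {cL : ℝ} (hcL : cL = 3 * dedekindZeta_residue K * ((n : ℝ) + 1))
    {KA : ℝ} (hKA : KA = Gmax ^ 2 * cL ^ (4 * k) * |Clev| * Φ)
    {KB : ℝ} (hKB : KB = Gmax ^ 2 * cL ^ (4 * k) * Φ *
      (C_s * 3 * c₂ ^ 2 * |Cω| * ((n : ℝ) + 2) ^ (4 ^ k) + c₂ * (|CN| * ((n : ℝ) + 1)) ^ (2 * k) * Cu * 3 ^ r))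
    {w : ℝ} (hw : w = (Ideal.absNorm (paramW K N) : ℝ)) (hw1 : 1 ≤ w) (hwlog : w ≤ Real.log N)
    {R : ℝ} (hRA : R = A ^ (θ / 2 - δ)) (hR2 : 2 ≤ R) (hlogR1 : 1 ≤ Real.log R)
    (hlogRN : Real.log R ≤ (n + 1) * Real.log N)
    {P : ℝ} (hPdef : P = dedekindZeta_residue K * dN * Real.log R) (hP0 : 0 < P)
    (hL3 : ∑ 𝔞 ∈ G1 K (paramW K N) R, 1 / idealTotient K 𝔞 ≤ 3 * P)
    (hlog2δ : Real.log N ≤ c₁ ^ (2 * δ) * N ^ (2 * δ)) (hsqrt : Real.log N ≤ 1 / c₂ * N ^ (1 / 2 : ℝ)) :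
    ∑ 𝔡 ∈ boxG K k (paramW K N) R, ∑ 𝔢 ∈ boxG K k (paramW K N) R,
        |lam K k R (smoothY K k G R (paramW K N)) 𝔡| * |lam K k R (smoothY K k G R (paramW K N)) 𝔢| *
          pairErr K k (paramW K N) h N m C_s Cu 𝔡 𝔢 ≤
      (KA / Real.log N + KB * Real.log N ^ (7 * k + 3 + 4 ^ k + r) * N ^ (-(1 : ℝ) / 2)) * (A / w * P ^ k) := by
  classical
  have hρ0 : 0 < dedekindZeta_residue K := dedekindZeta_residue_pos K
  have hCs0 : 0 ≤ C_s := hCs.nonneg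
  have hNpos : 0 < N := by linarith only [hN1]
  have hApos : 0 < A := by linarith only [hA1]
  have hR1 : 1 < R := by linarith only [hR2]
  have hRpos : 0 < R := by linarith only [hR2]
  have hw0 : 0 < w := by linarith only [hw1]
  have hΦ0 : 0 ≤ Φ := by rw [hΦ]; positivity
  have hcL0 : 0 ≤ cL := by rw [hcL]; positivity
  have hMT0 : 0 ≤ A / w * P ^ k := by positivity
  have hPle : P ≤ dedekindZeta_residue K * ((n : ℝ) + 1) * Real.log N := by
    rw [hPdef]
    calc dedekindZeta_residue K * dN * Real.log R ≤ dedekindZeta_residue K * 1 * ((n + 1) * Real.log N) :=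
          mul_le_mul (mul_le_mul_of_nonneg_left hd1 hρ0.le) hlogRN (by linarith only [hlogR1]) (by positivity)
      _ = _ := by ring
  -- the coefficients `y`
  have hy := supportedOn_smoothY k G R (paramW K N)
  have hyabs := abs_smoothY_le hGmax hG0 R (paramW K N) (k := k)
  have hyR : ∀ 𝔯, smoothY K k G R (paramW K N) 𝔯 ≠ 0 → ∏ i, (Ideal.absNorm (𝔯 i) : ℝ) ≤ R :=
    fun 𝔯 h𝔯 => prod_absNorm_le_of_smoothY_ne_zero hR1 h𝔯
  obtain ⟨L, hLdef⟩ : ∃ x : ℝ, x = ∑ 𝔞 ∈ G1 K (paramW K N) R, 1 / idealTotient K 𝔞 := ⟨_, rfl⟩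
  obtain ⟨LN, hLNdef⟩ : ∃ x : ℝ, x = ∑ 𝔞 ∈ G1 K (paramW K N) R, 1 / (Ideal.absNorm 𝔞 : ℝ) := ⟨_, rfl⟩
  rw [← hLdef] at hL3
  have hL0 : 0 ≤ L := by
    rw [hLdef]; exact Finset.sum_nonneg fun 𝔞 ha => (one_div_pos.2 (idealTotient_pos (mem_G1.1 ha).1.1)).le
  have hLN0 : 0 ≤ LN := by rw [hLNdef]; exact Finset.sum_nonneg fun _ _ => by positivity
  have hLNle : LN ≤ |CN| * ((n : ℝ) + 1) * Real.log N := by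
    calc LN ≤ CN * Real.log R := by rw [hLNdef]; exact hCN (paramW K N) R hR2
      _ ≤ |CN| * Real.log R := mul_le_mul_of_nonneg_right (le_abs_self _) (by linarith only [hlogR1])
      _ ≤ |CN| * ((n + 1) * Real.log N) := mul_le_mul_of_nonneg_left hlogRN (abs_nonneg _)
      _ = _ := by ring
  -- the pair-error sum
  have hpair := sum_lam_pairErr_le (squarefree_paramW N) hRpos.le hy hyR (abs_lam_le hy hyabs) h hN1 m hCs hCu
    (k := k)
  rw [← hLdef, ← hLNdef, ← hsc, ← hw, ← hr] at hpair
  -- `Q = N𝔴 R²`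
  obtain ⟨Q, hQ⟩ : ∃ x : ℝ, x = w * (R * R) := ⟨_, rfl⟩
  rw [← hQ] at hpair
  have hQle : Q ≤ c₂ * Real.log N * N ^ ((n : ℝ) / 2) := by
    rw [hQ]; exact s2_Q_le hN1 hc₂1 hA₂ hA1 hη2 hRA hwlog hlogN
  have hQ4 : 4 ≤ Q := by
    rw [hQ]
    have : (2 : ℝ) * 2 ≤ R * R := mul_le_mul hR2 hR2 (by norm_num) hRpos.le
    have h1 : 1 * (R * R) ≤ w * (R * R) := mul_le_mul_of_nonneg_right hw1 (by positivity)
    linarith only [this, h1]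
  have hQ1 : 1 ≤ Q := by linarith only [hQ4]
  have hQθ : Q ≤ (cardA K N : ℝ) ^ θ := by
    rw [← hA]
    have h1 : Real.log N ≤ A ^ (2 * δ) := by
      refine hlog2δ.trans ?_
      rw [← Real.mul_rpow hc₁0.le hNpos.le]
      refine Real.rpow_le_rpow (by positivity) ?_ (by positivity)
      calc c₁ * N = c₁ * N ^ 1 := by rw [pow_one]
        _ ≤ c₁ * N ^ n := mul_le_mul_of_nonneg_left (pow_le_pow_right₀ hN1 hn1) hc₁0.le
        _ ≤ A := hA₁
    have h2' : R * R = A ^ (θ - 2 * δ) := by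
      rw [hRA, ← Real.rpow_add hApos]; congr 1; ring
    rw [hQ, h2']
    calc w * A ^ (θ - 2 * δ) ≤ A ^ (2 * δ) * A ^ (θ - 2 * δ) :=
          mul_le_mul_of_nonneg_right (hwlog.trans h1) (by positivity)
      _ = A ^ θ := by rw [← Real.rpow_add hApos]; congr 1; ring
  have hQN : Q ≤ N ^ finrank ℚ K := by
    rw [← hn]
    have h1 : c₂ * Real.log N ≤ N ^ (1 / 2 : ℝ) := by
      have h2 := mul_le_mul_of_nonneg_left hsqrt (by linarith only [hc₂1] : (0 : ℝ) ≤ c₂)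
      have e : c₂ * (1 / c₂ * N ^ (1 / 2 : ℝ)) = N ^ (1 / 2 : ℝ) := by
        field_simp
      rwa [e] at h2
    calc Q ≤ c₂ * Real.log N * N ^ ((n : ℝ) / 2) := hQle
      _ ≤ N ^ (1 / 2 : ℝ) * N ^ ((n : ℝ) / 2) := mul_le_mul_of_nonneg_right h1 (by positivity)
      _ = N ^ (1 / 2 + (n : ℝ) / 2) := by rw [← Real.rpow_add hNpos]
      _ ≤ N ^ (n : ℝ) := Real.rpow_le_rpow_of_exponent_le hN1 (by
          have : (1 : ℝ) ≤ n := by exact_mod_cast hn1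
          linarith only [this])
      _ = N ^ n := Real.rpow_natCast N n
  -- the level-of-distribution sum
  obtain ⟨LEV, hLEVdef⟩ : ∃ x : ℝ, x = ∑ 𝔮 ∈ (idealsLE K Q).filter (fun 𝔮 => Squarefree 𝔮),
      ((4 : ℝ) ^ k) ^ omegaI 𝔮 * primesAErr K N 𝔮 := ⟨_, rfl⟩
  have hLEV0 : 0 ≤ LEV := by
    rw [hLEVdef]; exact Finset.sum_nonneg fun 𝔮 _ => mul_nonneg (by positivity) (primesAErr_nonneg _ _)
  have hLEV : LEV ≤ |Clev| * N ^ n / Real.log N ^ (5 * k + 2) := by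
    have h1 := hlevN Q hQθ hQN
    rw [← hLEVdef, ← hn] at h1
    exact h1.trans (div_le_div_of_nonneg_right (mul_le_mul_of_nonneg_right (le_abs_self _) (by positivity))
      (by positivity))
  -- the `∑ c^ω/φ` sum
  obtain ⟨Sω, hSωdef⟩ : ∃ x : ℝ, x = ∑ 𝔮 ∈ (idealsLE K Q).filter (fun 𝔮 => Squarefree 𝔮),
      ((4 : ℝ) ^ k) ^ omegaI 𝔮 / idealTotient K 𝔮 := ⟨_, rfl⟩
  have hSω0 : 0 ≤ Sω := by
    rw [hSωdef]
    exact Finset.sum_nonneg fun 𝔮 hq => div_nonneg (by positivity)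
      (idealTotient_pos (mem_idealsLE.1 (Finset.mem_filter.1 hq).1).1).le
  have hlogQ : Real.log Q ≤ ((n : ℝ) + 2) * Real.log N := by
    have h1 : Real.log Q ≤ Real.log (c₂ * Real.log N * N ^ ((n : ℝ) / 2)) :=
      Real.log_le_log (by linarith only [hQ1]) hQle
    rw [Real.log_mul (by positivity) (by positivity), Real.log_mul (by positivity) (by positivity),
      Real.log_rpow hNpos] at h1
    have h2' : Real.log (Real.log N) ≤ Real.log N := Real.log_le_self (by linarith only [hlogN])
    have h3' : (n : ℝ) / 2 * Real.log N ≤ n * Real.log N := by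
      have : (0 : ℝ) ≤ n * Real.log N := by positivity
      linarith only [this]
    linarith only [h1, h2', hlogc₂, h3']
  have hSω : Sω ≤ |Cω| * (((n : ℝ) + 2) * Real.log N) ^ (4 ^ k) := by
    have h1 := hCω Q (by linarith only [hQ4])
    rw [← hSωdef] at h1
    have hlogQ0 : 0 ≤ Real.log Q := Real.log_nonneg hQ1
    calc Sω ≤ Cω * Real.log Q ^ (4 ^ k) := h1
      _ ≤ |Cω| * Real.log Q ^ (4 ^ k) := mul_le_mul_of_nonneg_right (le_abs_self _) (by positivity)
      _ ≤ |Cω| * (((n : ℝ) + 2) * Real.log N) ^ (4 ^ k) :=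
          mul_le_mul_of_nonneg_left (pow_le_pow_left₀ hlogQ0 hlogQ _) (abs_nonneg _)
  -- `Y` and the shift/`C_s` sum
  have hNn : (N : ℝ) ^ n = N ^ (n : ℝ) := (Real.rpow_natCast N n).symm
  have hsplit : N ^ ((n : ℝ) - 1 / 2) = N ^ (-(1 : ℝ) / 2) * N ^ n := by
    rw [hNn, ← Real.rpow_add hNpos]; ring_nf
  obtain ⟨hY1, hY2, hY3⟩ := s2_Y_bounds' hn1 hN1 hlogN hc₂1 hQle hQ1
  rw [hsplit] at hY1 hY2 hY3
  rw [hn] at hY1 hY2 hY3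
  have hmod := sum_pow_omegaI_mul_modErr_le (hn ▸ hn1) (c := (4 : ℝ) ^ k) (by positivity) hCs0 hN1 hY1 hY2 hY3
    (K := K)
  rw [← hLEVdef, ← hSωdef, ← hn] at hmod
  -- the unit-count factor
  have hlogscN : 0 ≤ Real.log ((2 + sc) * N) := by
    refine Real.log_nonneg ?_
    have : (1 : ℝ) * 1 ≤ (2 + sc) * N := mul_le_mul (by linarith only [hsc0]) hN1 zero_le_one (by linarith only [hsc0])
    linarith only [this]
  have hU : Cu * (1 + Real.log ((2 + sc) * N)) ^ r ≤ Cu * (3 * Real.log N) ^ r := by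
    refine mul_le_mul_of_nonneg_left (pow_le_pow_left₀ (by linarith only [hlogscN]) ?_ _) hCu0
    rw [Real.log_mul (by linarith only [hsc0]) hNpos.ne']
    linarith only [hlogsc, hlogN]
  have hU0 : 0 ≤ Cu * (1 + Real.log ((2 + sc) * N)) ^ r :=
    mul_nonneg hCu0 (pow_nonneg (by linarith only [hlogscN]) _)
  -- `lmax²`, `R² L_N^{2k}`
  have hlmax : (Gmax * L ^ (2 * k)) ^ 2 ≤ Gmax ^ 2 * (cL * Real.log N) ^ (4 * k) := by
    have hLcL : L ≤ cL * Real.log N := by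
      have h1 : 3 * P ≤ 3 * (dedekindZeta_residue K * ((n : ℝ) + 1) * Real.log N) := by linarith only [hPle]
      calc L ≤ 3 * P := hL3
        _ ≤ 3 * (dedekindZeta_residue K * ((n : ℝ) + 1) * Real.log N) := h1
        _ = cL * Real.log N := by rw [hcL]; ring
    calc (Gmax * L ^ (2 * k)) ^ 2 = Gmax ^ 2 * (L ^ (2 * k)) ^ 2 := by ring
      _ ≤ Gmax ^ 2 * ((cL * Real.log N) ^ (2 * k)) ^ 2 := by
          refine mul_le_mul_of_nonneg_left (pow_le_pow_left₀ (by positivity) (pow_le_pow_left₀ hL0 hLcL _) 2)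
            (sq_nonneg _)
      _ = Gmax ^ 2 * (cL * Real.log N) ^ (4 * k) := by rw [← pow_mul]; ring_nf
  obtain ⟨hR2le, -⟩ := term2_pow_bounds hn1 hN1 hc₂1 hA₂ hA1 hη2 hRA hw1
  have hR2LN : (R * LN ^ k) ^ 2 ≤ c₂ * (N ^ (-(1 : ℝ) / 2) * N ^ n) * (|CN| * ((n : ℝ) + 1) * Real.log N) ^ (2 * k) := by
    rw [← hsplit]
    calc (R * LN ^ k) ^ 2 = R ^ 2 * (LN ^ k) ^ 2 := by ring
      _ ≤ (c₂ * N ^ ((n : ℝ) - 1 / 2)) * ((|CN| * ((n : ℝ) + 1) * Real.log N) ^ k) ^ 2 :=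
          mul_le_mul hR2le (pow_le_pow_left₀ (by positivity) (pow_le_pow_left₀ hLN0 hLNle _) 2)
            (by positivity) (by positivity)
      _ = _ := by rw [← pow_mul]; ring_nf
  -- the main term from below
  have hmainlow := term2_main_lower (k := k) hN1 hlogN hc₁0 hA₁ hlogR1 hρ0 hw1 hwlog hCφ0 hlD0 hlDle hdφ
  rw [← hPdef, show Real.log N ^ (k + 1) * (Cφ / dedekindZeta_residue K) ^ k / c₁ =
    Real.log N ^ (k + 1) * Φ by rw [hΦ]; ring] at hmainlow
  -- combine
  have hE23 := s2_E23_le (k := k) (n := n) (r := r) (M := A / w * P ^ k) hlogN (by positivity) (by positivity) hMT0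
    hlmax hcL0 hLEV0 hLEV (abs_nonneg Clev) hCs0 hSω0 hSω (abs_nonneg Cω) hc₂1 (sq_nonneg _) hR2LN
    (abs_nonneg CN) hU0 hU hCu0 hΦ0 hmainlow
  rw [← hKA, ← hKB] at hE23
  refine hpair.trans (le_trans ?_ hE23)
  rw [mul_assoc (C_s : ℝ)] at hmod
  refine add_le_add (mul_le_mul_of_nonneg_left hmod (sq_nonneg _)) ?_
  rw [mul_assoc]

/-- **Lemma 2.3 in `o`-form** (its error terms against `𝔐`): if `P` has level of distribution `θ`
and `|P(N)| log|A(N)| ≪ |A(N)|` (from `PrimesAsymptotic`), then for the data of Proposition 2.1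
there is `g → 0` with
`|S₂^{(m)} − (|P(N)|/φ(𝔴)) ∑_𝔲 (y^{(m)}_𝔲)²/∏ g(𝔲ᵢ)| ≤ g(N) 𝔐(N)` for all large `N`:
the `1/g`-junk is `≪ D₀^{-1/2} 𝔐` (using `|P(N)| log R ≪ |A(N)|`), the level-of-distribution sum is
`≪ 𝔐/log N` (`MaynardNFLevel` with `A = 5k+2`), and the shift and unit-count terms are
`≪ (log N)^{O_k(1)} N^{-1/2} 𝔐`.
[cite: CastilloEtAl2015, Lemma 2.3 and proof of Proposition 2.1] -/
theorem eventually_abs_S2_sub_le [IsTotallyReal K] (hk : 1 ≤ k) {h : Fin k → 𝓞 K}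
    (hinj : Function.Injective h) {θ δ : ℝ} (hδ : 0 < δ) (hη : 0 < θ / 2 - δ) (hθ : θ ≤ 1 / 2)
    (hlevel : PrimesHaveLevel K θ) (hP : PrimesAsymptotic K)
    {G : (Fin k → ℝ) → ℝ} (hG : Continuous G) {v₀ : ℝ → 𝓞 K} (m : Fin k)
    (hv₀ : ∀ N, Ideal.span {v₀ N + h m} ⊔ paramW K N = ⊤) :
    ∃ g : ℝ → ℝ, Tendsto g atTop (𝓝 0) ∧ ∀ᶠ N : ℝ in atTop,
      |sieveS2 K k h θ δ G v₀ N m - (primesA K N : ℝ) / idealTotient K (paramW K N) *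
          ∑ 𝔲 ∈ boxG K k (paramW K N) (nfR K θ δ N),
            ym K k (paramW K N) (nfR K θ δ N) (smoothY K k G (nfR K θ δ N) (paramW K N)) m 𝔲 ^ 2 /
              ∏ i, gId K (𝔲 i)| ≤ g N * nfMainTerm K k θ δ N := by
  classical
  -- constants
  obtain ⟨Gmax, hG0, hGmax⟩ : ∃ M : ℝ, 0 ≤ M ∧ ∀ x ∈ maynardSimplex k, |G x| ≤ M := by
    obtain ⟨M, hM⟩ := (isCompact_maynardSimplex k).exists_bound_of_continuousOn hG.continuousOn
    exact ⟨max M 0, le_max_right _ _, fun x hx => (hM x hx).trans (le_max_left _ _)⟩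
  obtain ⟨Cu, hCu1, hCu⟩ := exists_generatorCount (K := K)
  have hCu0 : 0 ≤ Cu := by linarith
  obtain ⟨C_s, hCs⟩ := exists_shiftBound (K := K) (h m)
  obtain ⟨CN, hCN⟩ := sum_G1_inv_absNorm_le (K := K)
  obtain ⟨CZ, hCZ0, hCZ⟩ := eventually_sqSum_pow_sub_one_le (K := K) 1 hη
  obtain ⟨CZg, hCZg0, hCZg⟩ := eventually_gSqSum_pow_sub_one_le (K := K) (Fintype.card (OffDiag k)) hη
  obtain ⟨Cφ, hCφ0, hCφ⟩ := one_div_le_idealTotient_paramW_div (K := K)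
  obtain ⟨Cw, hCw0, hCw⟩ := log_absNorm_paramW_le (K := K)
  have hρ0 : 0 < dedekindZeta_residue K := dedekindZeta_residue_pos K
  obtain ⟨n, hn⟩ : ∃ m : ℕ, m = finrank ℚ K := ⟨_, rfl⟩
  have hn1 : 1 ≤ n := by rw [hn]; exact finrank_pos
  obtain ⟨r, hr⟩ : ∃ m : ℕ, m = Units.rank K := ⟨_, rfl⟩
  have hℓ := boxDensity_pos (K := K)
  obtain ⟨c₁, hc₁⟩ : ∃ x : ℝ, x = boxDensity K / 2 * 2 ^ n := ⟨_, rfl⟩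
  have hc₁0 : 0 < c₁ := by rw [hc₁]; positivity
  obtain ⟨c₂, hc₂⟩ : ∃ x : ℝ, x = max 1 (2 * boxDensity K * 2 ^ n) := ⟨_, rfl⟩
  have hc₂1 : 1 ≤ c₂ := by rw [hc₂]; exact le_max_left _ _
  obtain ⟨Clev, N₀, hlev⟩ := hlevel.sum_pow_omegaI_mul_primesAErr_le (c := (4 : ℝ) ^ k) (by positivity)
    (A := ((5 * k + 2 : ℕ) : ℝ)) (by positivity)
  obtain ⟨Cω, hCω⟩ := sum_pow_omegaI_div_idealTotient_le (K := K) (c := (4 : ℝ) ^ k) (by positivity)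
  obtain ⟨sc, hsc⟩ : ∃ x : ℝ, x = CastilloEtAl2015.shiftConst K (h m) := ⟨_, rfl⟩
  have hsc0 : 0 ≤ sc := by rw [hsc]; unfold CastilloEtAl2015.shiftConst; positivity
  obtain ⟨ck, hck⟩ : ∃ x : ℝ, x = 1 + k * 2 ^ k := ⟨_, rfl⟩
  obtain ⟨K₁, hK₁⟩ : ∃ x : ℝ, x = 2 * Gmax ^ 2 * ck ^ 2 * 3 ^ (k + 1) * CZg := ⟨_, rfl⟩
  obtain ⟨Φ, hΦ⟩ : ∃ x : ℝ, x = (Cφ / dedekindZeta_residue K) ^ k / c₁ := ⟨_, rfl⟩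
  obtain ⟨cL, hcL⟩ : ∃ x : ℝ, x = 3 * dedekindZeta_residue K * ((n : ℝ) + 1) := ⟨_, rfl⟩
  obtain ⟨KA, hKA⟩ : ∃ x : ℝ, x = Gmax ^ 2 * cL ^ (4 * k) * |Clev| * Φ := ⟨_, rfl⟩
  obtain ⟨KB, hKB⟩ : ∃ x : ℝ, x = Gmax ^ 2 * cL ^ (4 * k) * Φ *
      (C_s * 3 * c₂ ^ 2 * |Cω| * ((n : ℝ) + 2) ^ (4 ^ k) + c₂ * (|CN| * ((n : ℝ) + 1)) ^ (2 * k) * Cu * 3 ^ r) :=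
    ⟨_, rfl⟩
  -- the function `g`
  refine ⟨fun N => K₁ * paramD0 N ^ (-(1 : ℝ) / 2) +
    (KA / Real.log N + KB * Real.log N ^ (7 * k + 3 + 4 ^ k + r) * N ^ (-(1 : ℝ) / 2)), ?_, ?_⟩
  · have h1 : Tendsto (fun N : ℝ => K₁ * paramD0 N ^ (-(1 / 2 : ℝ))) atTop (𝓝 (K₁ * 0)) :=
      ((tendsto_rpow_neg_atTop (by norm_num : (0 : ℝ) < 1 / 2)).comp tendsto_paramD0_atTop).const_mul _
    have h2 : Tendsto (fun N : ℝ => KA / Real.log N) atTop (𝓝 0) :=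
      (tendsto_const_nhds (x := KA)).div_atTop Real.tendsto_log_atTop
    have h3 := (tendsto_log_pow_mul_rpow_neg_half (7 * k + 3 + 4 ^ k + r)).const_mul KB
    rw [mul_zero] at h1 h3
    have h4 := h1.add (h2.add h3)
    rw [add_zero, zero_add] at h4
    refine h4.congr' (Eventually.of_forall fun N => ?_)
    simp only [← mul_assoc]
    norm_num
  -- the eventual facts
  have hA := tendsto_cardA_atTop (K := K)
  have hRt := tendsto_nfR_atTop (K := K) hη
  have hPn2 : ∀ᶠ N : ℝ in atTop, dedekindZeta_residue K *
      ((primesA K N : ℝ) * Real.log (cardA K N) / cardA K N) ≤ 2 :=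
    (tendsto_delta_of_primesAsymptotic hP).eventually (eventually_le_nhds (by norm_num))
  have hCZ1ev : ∀ᶠ N : ℝ in atTop, CZ * paramD0 N ^ (-(1 : ℝ) / 2) ≤ 1 := by
    have h1 : Tendsto (fun N : ℝ => CZ * paramD0 N ^ (-(1 / 2 : ℝ))) atTop (𝓝 (CZ * 0)) :=
      ((tendsto_rpow_neg_atTop (by norm_num : (0 : ℝ) < 1 / 2)).comp tendsto_paramD0_atTop).const_mul _
    rw [mul_zero] at h1
    refine (h1.eventually (eventually_le_nhds one_pos)).mono fun N hN => ?_
    have e : -(1 / 2 : ℝ) = -(1 : ℝ) / 2 := by norm_num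
    rwa [e] at hN
  filter_upwards [eventually_ge_atTop (1 : ℝ), (Real.tendsto_log_atTop).eventually_ge_atTop 1,
    (Real.tendsto_log_atTop).eventually_ge_atTop (Real.log c₂),
    (Real.tendsto_log_atTop).eventually_ge_atTop (Real.log (2 + sc)),
    tendsto_paramD0_atTop.eventually_ge_atTop 2, eventually_cardA_bounds (K := K),
    hA.eventually_ge_atTop 2, hRt.eventually_ge_atTop 2, hRt.eventually_ge_atTop (Real.exp 1),
    eventually_shift_dvd_paramW (K := K) hinj, eventually_sum_G1_le_three (K := K) hη,
    eventually_sum_G1_inv_gId_le_three (K := K) hη, hCZ, hCZg, hCZ1ev,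
    eventually_exp_mul_paramD0_le Cw one_pos, eventually_exp_mul_paramD0_le 1 one_pos, hPn2,
    eventually_log_le_mul_rpow (s := 2 * δ) (by positivity) (Real.rpow_pos_of_pos hc₁0 (2 * δ)),
    eventually_log_le_mul_rpow (s := 1 / 2) (by norm_num) (one_div_pos.2 (by linarith : (0 : ℝ) < c₂)),
    eventually_ge_atTop N₀, eventually_dvd_paramW_of_absNorm_le (K := K) 3]
    with N hN1 hlogN hlogc₂ hlogsc hD2 hAb hA2 hR2 hRe hh hL3 hLg3 hτ hτg hCZ1 hexpw hexp1 hPn2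
      hlog2δ hsqrt hN₀ h3
  rw [← hn] at hAb
  -- notation and basic facts at `N`
  obtain ⟨w, hw⟩ : ∃ x : ℝ, x = (Ideal.absNorm (paramW K N) : ℝ) := ⟨_, rfl⟩
  have hw1 : 1 ≤ w := by
    rw [hw]; exact_mod_cast Nat.one_le_iff_ne_zero.2 (by
      rw [Ne, Ideal.absNorm_eq_zero_iff]; exact paramW_ne_bot N)
  have hw0 : 0 < w := by linarith only [hw1]
  obtain ⟨R, hR⟩ : ∃ x : ℝ, x = nfR K θ δ N := ⟨_, rfl⟩
  rw [← hR] at hR2 hRe hL3 hLg3 hτ hτg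
  have hR1 : 1 < R := by linarith only [hR2]
  have hRpos : 0 < R := by linarith only [hR2]
  have hlogR1 : 1 ≤ Real.log R := by
    rw [Real.le_log_iff_exp_le hRpos]; exact hRe
  obtain ⟨A, hAdef⟩ : ∃ x : ℝ, x = (cardA K N : ℝ) := ⟨_, rfl⟩
  rw [← hAdef] at hAb hA2 hPn2
  have hA1 : 1 ≤ A := by linarith only [hA2]
  have hApos : 0 < A := by linarith only [hA2]
  have hNpos : 0 < N := by linarith only [hN1]
  have hlogA0 : 0 < Real.log A := Real.log_pos (by linarith only [hA2])
  obtain ⟨dN, hdN⟩ : ∃ x : ℝ, x = idealTotient K (paramW K N) / (Ideal.absNorm (paramW K N) : ℝ) := ⟨_, rfl⟩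
  rw [← hdN] at hL3 hLg3
  have hd1 : dN ≤ 1 := by rw [hdN]; exact idealTotient_div_absNorm_le_one (paramW_ne_bot N)
  have hdφ : 1 / (Cφ * Real.log (paramD0 N)) ≤ dN := by rw [hdN]; exact hCφ N hD2
  have hlD0 : 0 < Real.log (paramD0 N) := Real.log_pos (by linarith only [hD2])
  have hd0 : 0 < dN := lt_of_lt_of_le (by positivity) hdφ
  have hφeq : idealTotient K (paramW K N) = dN * w := by
    rw [hdN, hw, div_mul_cancel₀ _ (by rw [← hw]; exact hw0.ne')]
  obtain ⟨P, hPdef⟩ : ∃ x : ℝ, x = dedekindZeta_residue K * dN * Real.log R := ⟨_, rfl⟩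
  have hP0 : 0 < P := by rw [hPdef]; positivity
  rw [← hPdef] at hL3 hLg3
  obtain ⟨Pn, hPn⟩ : ∃ x : ℝ, x = (primesA K N : ℝ) := ⟨_, rfl⟩
  have hPn0 : 0 ≤ Pn := by rw [hPn]; exact Nat.cast_nonneg _
  rw [← hPn] at hPn2
  -- the main term
  have hMT : nfMainTerm K k θ δ N = A / w * P ^ k := by
    rw [nfMainTerm_eq, ← hdN, ← hAdef, ← hw, ← hR, ← hPdef]
  -- `A` versus `N`
  have hA₁ : c₁ * N ^ n ≤ A := by
    have h1 := hAb.1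
    rw [mul_pow] at h1
    have e : c₁ * N ^ n = boxDensity K / 2 * (2 ^ n * N ^ n) := by rw [hc₁]; ring
    rw [e]; exact h1
  have hA₂ : A ≤ c₂ * N ^ n := by
    have h1 := hAb.2
    rw [mul_pow] at h1
    calc A ≤ 2 * boxDensity K * (2 ^ n * N ^ n) := h1
      _ = (2 * boxDensity K * 2 ^ n) * N ^ n := by ring
      _ ≤ c₂ * N ^ n := mul_le_mul_of_nonneg_right (by rw [hc₂]; exact le_max_right _ _) (by positivity)
  have hη2 : 2 * (θ / 2 - δ) ≤ 1 / 2 := by linarith only [hθ, hδ]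
  have hRA : R = A ^ (θ / 2 - δ) := by rw [hR, hAdef]; rfl
  have hlogRA : Real.log R = (θ / 2 - δ) * Real.log A := by rw [hR, hAdef]; exact log_nfR θ δ (hAdef ▸ hApos)
  have hlogRleA : Real.log R ≤ Real.log A := by
    rw [hlogRA]
    have h1 : (θ / 2 - δ) * Real.log A ≤ 1 * Real.log A :=
      mul_le_mul_of_nonneg_right (by linarith only [hθ, hδ]) hlogA0.le
    linarith only [h1]
  have hlogRN : Real.log R ≤ (n + 1) * Real.log N := by
    have hlogA : Real.log A ≤ Real.log c₂ + n * Real.log N := by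
      have h1 : Real.log A ≤ Real.log (c₂ * N ^ n) := Real.log_le_log hApos hA₂
      rw [Real.log_mul (by positivity) (by positivity), Real.log_pow] at h1
      exact h1
    have h4 : ((n : ℕ) : ℝ) * Real.log N + Real.log N = (n + 1) * Real.log N := by ring
    linarith only [hlogRleA, hlogA, hlogc₂, h4]
  have hwlog : w ≤ Real.log N := by
    have h1 : Real.log w ≤ Cw * paramD0 N := by rw [hw]; exact hCw N hD2
    have h2 : w ≤ Real.exp (Cw * paramD0 N) := by
      rw [← Real.exp_log hw0]; exact Real.exp_le_exp.2 h1
    rw [Real.rpow_one] at hexpw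
    exact h2.trans hexpw
  have hlDle : Real.log (paramD0 N) ≤ Real.log N := by
    have h1 : Real.log (paramD0 N) ≤ Real.exp (1 * paramD0 N) := by
      have h2 : Real.log (paramD0 N) ≤ paramD0 N :=
        (Real.log_le_sub_one_of_pos (by linarith only [hD2])).trans (by linarith only [hD2])
      rw [one_mul]
      exact h2.trans (by linarith only [Real.add_one_le_exp (paramD0 N)])
    rw [Real.rpow_one] at hexp1
    exact h1.trans hexp1
  -- primes of norm `2` divide `𝔴`
  have h2 : ∀ P : Ideal (𝓞 K), Prime P → Ideal.absNorm P = 2 → P ∣ paramW K N := fun P hP hP2 =>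
    h3 P hP (by rw [hP2]; norm_num)
  -- the `G1`-sums for the junk term
  obtain ⟨L, hLdef⟩ : ∃ x : ℝ, x = ∑ 𝔞 ∈ G1 K (paramW K N) R, 1 / idealTotient K 𝔞 := ⟨_, rfl⟩
  obtain ⟨Lg, hLgdef⟩ : ∃ x : ℝ, x = ∑ 𝔞 ∈ G1 K (paramW K N) R, 1 / gId K 𝔞 := ⟨_, rfl⟩
  obtain ⟨T, hTdef⟩ : ∃ x : ℝ, x = (∑ 𝔞 ∈ G1 K (paramW K N) R, 1 / gId K 𝔞 ^ 2) ^ Fintype.card (OffDiag k) - 1 :=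
    ⟨_, rfl⟩
  have hL3' := hL3
  rw [← hLdef] at hL3
  rw [← hLgdef] at hLg3
  rw [← hTdef] at hτg
  rw [pow_one] at hτ
  have hZ1 : ∑ 𝔞 ∈ G1 K (paramW K N) R, 1 / idealTotient K 𝔞 ^ 2 - 1 ≤ 1 := hτ.2.trans hCZ1
  have hL0 : 0 ≤ L := by
    rw [hLdef]; exact Finset.sum_nonneg fun 𝔞 ha => (one_div_pos.2 (idealTotient_pos (mem_G1.1 ha).1.1)).le
  have hLg0 : 0 ≤ Lg := by
    rw [hLgdef]; exact Finset.sum_nonneg fun 𝔞 ha => (one_div_pos.2 (gId_pos_of_mem_G1 h2 ha)).le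
  -- `y^{(m)}_max` and Lemma 2.3, combinatorial form
  have hy := supportedOn_smoothY k G R (paramW K N)
  have hyabs := abs_smoothY_le hGmax hG0 R (paramW K N) (k := k)
  have hym : ∀ 𝔲 ∈ boxG K k (paramW K N) R, |ym K k (paramW K N) R (smoothY K k G R (paramW K N)) m 𝔲| ≤
      Gmax * L * ck := by
    intro 𝔲 hu
    have := abs_ym_le_of h2 hy hyabs hu hZ1 (m := m)
    rwa [← hLdef, ← hck] at this
  have hmain := abs_S2_sub_main_le (paramW_ne_bot N) h2 hR1.le hy hym hh (hv₀ N) hCs hCu hN1 (k := k)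
  rw [← hLgdef, ← hTdef, ← hPn, hφeq] at hmain
  -- E₁
  have hPnA : dedekindZeta_residue K * Pn * Real.log A ≤ 2 * A := by
    have h1 := hPn2
    rw [mul_div_assoc', div_le_iff₀ hApos] at h1
    linarith only [h1]
  have hE1 := s2_E1_le (k := k) hk (Gmax := Gmax) (ck := ck) hPn0 hd0 hw0 hL0 hL3 hLg0 hLg3 hP0.le hτg.1 hτg.2
    hPdef hρ0.le hlogRleA hPnA
  rw [← hK₁] at hE1
  -- E₂ + E₃
  have hlevN : ∀ Q : ℝ, Q ≤ (cardA K N : ℝ) ^ θ → Q ≤ N ^ finrank ℚ K →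
      ∑ 𝔮 ∈ (idealsLE K Q).filter (fun 𝔮 => Squarefree 𝔮), ((4 : ℝ) ^ k) ^ omegaI 𝔮 * primesAErr K N 𝔮 ≤
        Clev * N ^ finrank ℚ K / Real.log N ^ (5 * k + 2) := by
    intro Q hQ1 hQ2
    have h1 := hlev N hN₀ Q hQ1 hQ2
    rwa [Real.rpow_natCast] at h1
  have hCω' : ∀ x : ℝ, 2 ≤ x →
      ∑ 𝔮 ∈ (idealsLE K x).filter (fun 𝔮 => Squarefree 𝔮), ((4 : ℝ) ^ k) ^ omegaI 𝔮 / idealTotient K 𝔮 ≤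
        Cω * Real.log x ^ (4 ^ k) := by
    intro x hx
    have h1 := hCω x hx
    rwa [show ((4 : ℝ) ^ k) = ((4 ^ k : ℕ) : ℝ) by push_cast; ring, Real.rpow_natCast,
      show (((4 ^ k : ℕ) : ℝ)) = (4 : ℝ) ^ k by push_cast; ring] at h1
  have hpair := s2_pairErr_sum_le_at (k := k) hδ hη2 hG0 hGmax hN1 hlogN hCu0 hCu hCs hCN hn hn1 hr hlevN hCω'
    hc₁0 hA₁ hAdef hA1 hc₂1 hA₂ hlogc₂ hsc hsc0 hlogsc hCφ0 hdφ hd1 hlD0 hlDle hΦ hcL hKA hKB hw hw1 hwlog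
    hRA hR2 hlogR1 hlogRN hPdef hP0 hL3' hlog2δ hsqrt (m := m)
  -- assemble
  simp only [sieveS2]
  rw [← hR, hMT, ← hPn, hφeq]
  refine hmain.trans ?_
  rw [add_mul]
  exact add_le_add hE1 hpair

/-! ### Proposition 2.1, the `S₂` asymptotic -/

/-- **Proposition 2.1, the `S₂` asymptotic, PROVED from Theorem 2.7 (as the hypothesis
`PrimesHaveLevel K θ`) and the prime number theorem for `P(N)` (as the hypothesis
`PrimesAsymptotic K`)**: for `k ≥ 1`, distinct shifts, `0 < δ`, `0 < θ/2 − δ`, `θ ≤ 1/2`, continuous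
`G`, classes `v₀(N)` with `(v₀(N) + hᵢ, 𝔴(N)) = 1`, and every `m`,
`S₂^{(m)} = (1 + o(1)) φ(𝔴)^k |P(N)| (c_K log R)^{k+1} J_k^{(m)}(F)/N𝔴^{k+1}`:
`S₂^{(m)} − 𝔐 (c_K log R |P|/|A|) J = (S₂^{(m)} − X'Σ) + X'(Σ − P^{k+1} J)` with `X' = |P(N)|/φ(𝔴)`,
the first bracket `o(𝔐)` by `eventually_abs_S2_sub_le` (Lemma 2.3), the second by
`MaynardNFS2Sum.S2sum_isLittleO` (Lemma 2.4 + Maynard's Lemma 6.3 over `𝓞_K`) and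
`X' P^{k+1} = 𝔐 · c_K log R |P(N)|/|A(N)| ≤ 2𝔐`.
[cite: CastilloEtAl2015, Proposition 2.1 (S₂), Lemmas 2.3, 2.4, Theorem 2.7] -/
theorem S2_asymptotic [IsTotallyReal K] (hk : 0 < k) {h : Fin k → 𝓞 K} (hinj : Function.Injective h)
    {θ δ : ℝ} (hδ : 0 < δ) (hη : 0 < θ / 2 - δ) (hθ : θ ≤ 1 / 2) (hlevel : PrimesHaveLevel K θ)
    (hP : PrimesAsymptotic K) {G : (Fin k → ℝ) → ℝ} (hG : Continuous G) (v₀ : ℝ → 𝓞 K)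
    (hv₀ : ∀ N i, Ideal.span {v₀ N + h i} ⊔ paramW K N = ⊤) (m : Fin k) :
    S2Asymptotic K k h θ δ G v₀ m := by
  obtain ⟨n, rfl⟩ : ∃ n, k = n + 1 := ⟨k - 1, by omega⟩
  classical
  unfold S2Asymptotic
  -- notation
  obtain ⟨J, hJ⟩ : ∃ x : ℝ, x = maynardJ (n + 1) m ((maynardSimplex (n + 1)).indicator G) := ⟨_, rfl⟩
  obtain ⟨Sg, hSg⟩ : ∃ f : ℝ → ℝ, f = fun N => ∑ 𝔲 ∈ boxG K (n + 1) (paramW K N) (nfR K θ δ N),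
      ym K (n + 1) (paramW K N) (nfR K θ δ N) (smoothY K (n + 1) G (nfR K θ δ N) (paramW K N)) m 𝔲 ^ 2 /
        ∏ i, gId K (𝔲 i) := ⟨_, rfl⟩
  obtain ⟨X, hX⟩ : ∃ f : ℝ → ℝ, f = fun N => (primesA K N : ℝ) / idealTotient K (paramW K N) := ⟨_, rfl⟩
  obtain ⟨Pk, hPk⟩ : ∃ f : ℝ → ℝ, f = fun N => (dedekindZeta_residue K *
      (∑ 𝔢 ∈ idealDivisors K (paramW K N), (idealMoebius 𝔢 : ℝ) / Ideal.absNorm 𝔢) *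
        Real.log (nfR K θ δ N)) ^ (n + 1 + 1) := ⟨_, rfl⟩
  obtain ⟨ρr, hρr⟩ : ∃ f : ℝ → ℝ, f = fun N => dedekindZeta_residue K * Real.log (nfR K θ δ N) *
      (primesA K N : ℝ) / cardA K N := ⟨_, rfl⟩
  have hρ0 : 0 < dedekindZeta_residue K := dedekindZeta_residue_pos K
  -- the algebraic identity `X P^{k+1} = 𝔐 ρr` (for `|A(N)| ≠ 0`)
  have hid : ∀ N, (cardA K N : ℝ) ≠ 0 → X N * Pk N = nfMainTerm K (n + 1) θ δ N * ρr N := by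
    intro N hA
    have hw : (Ideal.absNorm (paramW K N) : ℝ) ≠ 0 :=
      Nat.cast_ne_zero.2 (by rw [Ne, Ideal.absNorm_eq_zero_iff]; exact paramW_ne_bot N)
    have hφ : idealTotient K (paramW K N) ≠ 0 := (idealTotient_pos (paramW_ne_bot N)).ne'
    rw [hX, hPk, hρr]
    beta_reduce
    rw [nfMainTerm_eq, dsum_paramW_eq, pow_succ]
    obtain ⟨Y, hY⟩ : ∃ y : ℝ, y = (dedekindZeta_residue K *
        (idealTotient K (paramW K N) / (Ideal.absNorm (paramW K N) : ℝ)) * Real.log (nfR K θ δ N)) ^ (n + 1) :=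
      ⟨_, rfl⟩
    rw [← hY]
    field_simp
  -- (1) Lemma 2.3: `S₂ − X Σ = o(𝔐)`
  obtain ⟨g, hg, hev⟩ := eventually_abs_S2_sub_le (k := n + 1) (Nat.succ_pos n) hinj hδ hη hθ hlevel hP hG m
    (fun N => hv₀ N m)
  have e1 : (fun N => sieveS2 K (n + 1) h θ δ G v₀ N m - X N * Sg N) =o[atTop] nfMainTerm K (n + 1) θ δ := by
    rw [Asymptotics.isLittleO_iff]
    intro c hc
    filter_upwards [hev, hg.eventually (eventually_le_nhds hc), eventually_nfMainTerm_pos (K := K) (n + 1) hη]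
      with N h1 h2 h3
    rw [Real.norm_eq_abs, Real.norm_eq_abs, abs_of_pos h3, hX, hSg]
    exact h1.trans (mul_le_mul_of_nonneg_right h2 h3.le)
  -- (2) the main term of the sum: `Σ − Pk J = o(Pk)`
  have h2ev : ∀ᶠ N : ℝ in atTop, ∀ P : Ideal (𝓞 K), Prime P → Ideal.absNorm P = 2 → P ∣ paramW K N := by
    filter_upwards [eventually_dvd_paramW_of_absNorm_le (K := K) 2] with N hN P hP h2
    exact hN P hP (by rw [h2]; norm_num)
  have hsum := S2sum_isLittleO (K := K) hG m (𝔴 := fun N => paramW K N) (D₀ := paramD0) (R := nfR K θ δ)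
    (fun N => paramW_ne_bot N) h2ev tendsto_paramD0_atTop
    (fun N P hP hle => dvd_paramW_of_prime_of_absNorm_le hP hle) (tendsto_nfR_atTop hη)
    tendsto_eps_param (tendsto_E_param hη)
  rw [← hJ] at hsum
  have hsum' : (fun N => Sg N - Pk N * J) =o[atTop] Pk := by rw [hSg, hPk]; exact hsum
  -- (3) `X (Σ − Pk J) = o(𝔐)`
  have hρr2 : ∀ᶠ N : ℝ in atTop, 0 ≤ ρr N ∧ ρr N ≤ 2 := by
    have hPn2 : ∀ᶠ N : ℝ in atTop, dedekindZeta_residue K *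
        ((primesA K N : ℝ) * Real.log (cardA K N) / cardA K N) ≤ 2 :=
      (tendsto_delta_of_primesAsymptotic hP).eventually (eventually_le_nhds (by norm_num))
    filter_upwards [hPn2, (tendsto_cardA_atTop (K := K)).eventually_ge_atTop 1,
      (tendsto_nfR_atTop (K := K) hη).eventually_ge_atTop 1] with N h1 hA1 hR1
    have hA0 : 0 < (cardA K N : ℝ) := by linarith
    have hlogR : Real.log (nfR K θ δ N) ≤ Real.log (cardA K N) := by
      rw [log_nfR θ δ hA0]
      have hlogA0 : 0 ≤ Real.log (cardA K N) := Real.log_nonneg hA1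
      have : (θ / 2 - δ) * Real.log (cardA K N) ≤ 1 * Real.log (cardA K N) :=
        mul_le_mul_of_nonneg_right (by linarith) hlogA0
      linarith
    have hPn0 : 0 ≤ (primesA K N : ℝ) := Nat.cast_nonneg _
    rw [hρr]
    constructor
    · have := Real.log_nonneg hR1
      positivity
    · calc dedekindZeta_residue K * Real.log (nfR K θ δ N) * (primesA K N : ℝ) / cardA K N
          ≤ dedekindZeta_residue K * Real.log (cardA K N) * (primesA K N : ℝ) / cardA K N := by
            refine div_le_div_of_nonneg_right ?_ hA0.le
            exact mul_le_mul_of_nonneg_right (mul_le_mul_of_nonneg_left hlogR hρ0.le) hPn0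
        _ = dedekindZeta_residue K * ((primesA K N : ℝ) * Real.log (cardA K N) / cardA K N) := by ring
        _ ≤ 2 := h1
  have hXPk : (fun N => X N * Pk N) =O[atTop] nfMainTerm K (n + 1) θ δ := by
    refine Asymptotics.IsBigO.of_bound 2 ?_
    filter_upwards [hρr2, (tendsto_cardA_atTop (K := K)).eventually_gt_atTop 0,
      eventually_nfMainTerm_pos (K := K) (n + 1) hη] with N h1 hA0 hM
    rw [hid N hA0.ne', Real.norm_eq_abs, Real.norm_eq_abs, abs_of_pos hM, abs_of_nonneg (mul_nonneg hM.le h1.1)]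
    nlinarith [h1.2, hM]
  have e3 : (fun N => X N * (Sg N - Pk N * J)) =o[atTop] nfMainTerm K (n + 1) θ δ :=
    ((isBigO_refl X atTop).mul_isLittleO hsum').trans_isBigO hXPk
  -- (4) combine
  have etot := e1.add e3
  refine etot.congr' ?_ EventuallyEq.rfl
  filter_upwards [(tendsto_cardA_atTop (K := K)).eventually_gt_atTop 0] with N hA0
  have h := hid N hA0.ne'
  rw [hρr] at h
  simp only [] at h
  rw [← hJ]
  have e : nfMainTerm K (n + 1) θ δ N * (dedekindZeta_residue K * Real.log (nfR K θ δ N) *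
      (primesA K N : ℝ) / cardA K N) * J = X N * Pk N * J := by rw [h]
  rw [e]
  ring

end Literature.NumberTheory.Sieve.MaynardNF
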